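import Literature.Geometry.Riemannian.LowEntropyHypersurfacesFour
import Literature.Geometry.Riemannian.ShrinkingSphereEntropy
import Literature.Geometry.Riemannian.ColdingMinicozziEntropyValuesProofs
import Literature.Geometry.Riemannian.ColdingMinicozziEntropyFinite
import Literature.Geometry.Riemannian.ColdingMinicozziEntropyLowerBound
import Literature.Geometry.Riemannian.ColdingMinicozziEntropyDensity
import Literature.Geometry.Riemannian.ColdingMinicozziEntropyAchieved
import Literature.MeasureTheory.Hausdorff.SmoothImageHausdorffFinite
import Literature.Topology.FourManifolds.ImmersionCriterion
import Literature.Topology.FourManifolds.KnotFraming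
import Literature.AlgebraicTopology.FundamentalGroup.SphereSimplyConnected
import Literature.Geometry.Manifold.StabilityOfEmbeddings
import Literature.Geometry.Riemannian.ShrinkingSphereMCF
import Literature.Geometry.Riemannian.LevelSetFlowExtinction
import Literature.Geometry.Riemannian.LevelSetFlowWeakSetFlow
import Literature.Geometry.Riemannian.MCFEntropyMonotonicity
import Literature.Geometry.Riemannian.MCFRegularPointDensity

/-!
# Low-entropy hypersurfaces of `ℝ⁵` (Chodosh–Mantoulidis–Schulze 2025, Cor. 1.5): proved steps

Sibling proof file of `LowEntropyHypersurfacesFour.lean`, whose named fact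
`ChodoshMantoulidisSchulze2025_lowEntropy_sphere_four` renders Cor. 1.5 (a), (b) (= Cor. 1.22 for
`n = 4`) of O. Chodosh, C. Mantoulidis, F. Schulze, *Mean curvature flow with generic low-entropy
initial data II*, Duke Math. J. 174 (2025), arXiv:2309.03856, as the two diffeomorphism
statements "`λ(M) ≤ λ(𝕊³ × ℝ)` ⇒ `M ≅ 𝕊⁴`" and "`M` simply connected, `λ(M) ≤ λ(𝕊² × ℝ²)` ⇒
`M ≅ 𝕊⁴`" for a closed connected embedded hypersurface `ι : M⁴ ↪ ℝ⁵`.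

## What is proved here

The printed proof of Cor. 1.22 (arXiv text, §1.6, p. 6) reads: "either `M` is a round sphere (in
which case we are done), or we can find a small `C^∞` graph `M'` over `M` so that `λ(M) < Λ` and
so that there is `ℳ' ∈ 𝔉(M')` with `sing_non-gen ℳ' = ∅` [Thm. 1.13]. Then, in case (a), we have
`λ(ℳ') < λ(𝕊ⁿ⁻¹)` so `ℳ'` can only have multiplicity-one `𝕊ⁿ`-type singularities. Thus, the mean
curvature flow is completely smooth until it becomes a round sphere. In case (b), we additionally
use the surgery of [Daniels-Holgate]." The rendering in the fact file keeps of the resulting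
smooth isotopy only its endpoint: an embedding of `M` onto a round sphere. This file proves the
two differential-topological steps of that argument which the tree can state:

* `nonempty_diffeomorph_sphere_of_range_eq_sphere` — **isotopy endpoint ⇒ diffeomorphism**: if a
  `C^m` embedding `e : M → E` of an `n`-manifold into an `(n+1)`-dimensional inner product space
  has image exactly a round sphere `sphere c r`, `r > 0`, then `M ≃ₘ 𝕊ⁿ` (the unit sphere of `E`
  with Mathlib's stereographic structure). This is the uniqueness of the smooth structure of an
  embedded submanifold (Lee, *Introduction to Smooth Manifolds*, 2nd ed., Cor. 5.30 and
  Thm. 5.31): the corestriction `M → 𝕊ⁿ` is smooth (`ContMDiff.codRestrict_sphere`), and its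
  inverse is smooth because its composite with the immersion `e` is the smooth inclusion
  `𝕊ⁿ ⊆ E` (Mathlib's `ContMDiff.iff_comp_isImmersion`, the universal property of immersions);
  no compactness is needed.
* `nonempty_diffeomorph_sphere_four_of_range_eq_sphere` — the `n = 4` instance in the typeclass
  context of the fact: **the round case of Cor. 1.22** ("either `M` is a round sphere, in which
  case we are done") for hypersurfaces of `ℝ⁵`, unconditionally and without any entropy
  hypothesis.
* **Stone's ladder for hypersurfaces of `ℝ⁵`.** Case (a) of the printed proof ("`λ(ℳ') < λ(𝕊ⁿ⁻¹)`
  so `ℳ'` can only have multiplicity-one `𝕊ⁿ`-type singularities") rests on the ordering of the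
  entropies of the generic shrinkers `𝕊ʲ(√(2j)) × ℝⁿ⁻ʲ`, `λ(𝕊ʲ × ℝⁿ⁻ʲ) = λ(𝕊ʲ) = Λⱼ` (Rem. 1.7,
  Rem. 1.9 of the paper: "Stone computed the entropies of spheres … to be
  `2 > λ(𝕊¹) = √(2π/e) ≈ 1.52 > 3/2 > λ(𝕊²) = 4/e ≈ 1.47 > ⋯ > λ(𝕊ⁿ)`"). With Stone's constant
  `sphereEntropy k = Λ_k = |𝕊ᵏ| (k/(2πe))^{k/2}` of `ColdingMinicozziEntropyValues.lean` (where
  `Λ₁ = √(2π/e)`, `Λ₂ = 4/e` and `Λ₂ < Λ₁` are proved) we prove the closed forms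
  `sphereEntropy_three : Λ₃ = 2π² (3/(2πe))^{3/2}` (`≈ 1.4531`) and
  `sphereEntropy_four : Λ₄ = 32/(3e²)` (`≈ 1.4436`), and the `n = 4` ladder
  `1 < Λ₄ < Λ₃ < Λ₂ (< Λ₁)` (`one_lt_sphereEntropy_four`,
  `sphereEntropy_four_lt_sphereEntropy_three` ⟺ `2048 < 243πe`,
  `sphereEntropy_three_lt_sphereEntropy_two` ⟺ `27π < 32e`); hence, under the named fact
  `Stone1994_cylinderEntropy` (`λ(𝕊ᵏ(√(2k)) × ℝ⁴⁻ᵏ) = Λ_k`), the thresholds of Cor. 1.5 (a) and (b)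
  for `n = 4` are ordered: `λ(shrinkingCylinder 4 3) < λ(shrinkingCylinder 4 2) <
  λ(shrinkingCylinder 4 1)` (`Stone1994_cylinderEntropy.gaussianEntropy_shrinkingCylinder_four_…`).
* **The round sphere (non-vacuity of the hypotheses).** Unconditionally, every round `k`-sphere
  (any centre, any radius `r > 0`) of a `(k+1)`-dimensional inner product space has entropy `Λ_k`
  (`gaussianEntropy_sphere_of_pos`, from the tree's `gaussianEntropy_shrinkingSphere`,
  Colding–Minicozzi 2012 Lemma 7.10, and the invariances of `λ`); in `ℝ⁵`,
  `λ(sphere c r) = 32/(3e²)` (`gaussianEntropy_sphere_four`). The inclusion `𝕊ⁿ ⊆ ℝⁿ⁺¹` is a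
  `C^∞` embedding (`isSmoothEmbedding_subtypeVal_sphere`, immersion criterion of the tree), and
  `𝕊⁴` is simply connected (`Literature.AlgebraicTopology.FundamentalGroup`); so, granted Stone's
  cylinder values, `(M, ι) = (𝕊⁴, incl)` satisfies every hypothesis of BOTH conjuncts of the fact
  with strict entropy inequalities (`…lowEntropy_sphere_four.hypotheses_unitSphere`) — the
  statement is not vacuous, and its conclusion holds there by `Diffeomorph.refl`.
* **Finiteness of `λ(ι(M))` (Colding–Minicozzi 2012, Lemma 7.2).** For every `(M, ι)` as in
  the fact — a compact `4`-manifold with a `C^∞` embedding `ι : M → ℝ⁵` (connectedness and the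
  entropy hypotheses are not needed) — the image has finite area `μHE[4] (range ι) < ∞`
  (`euclideanHausdorffMeasure_range_lt_top_of_isSmoothEmbedding`, from the tree's
  `Literature.MeasureTheory.Hausdorff.euclideanHausdorffMeasure_range_lt_top`) and **finite
  entropy** `gaussianEntropy 4 (range ι) < ∞` (`gaussianEntropy_range_lt_top_of_isSmoothEmbedding`,
  from `Literature.Geometry.Riemannian.gaussianEntropy_range_lt_top`: closed immersed
  submanifolds have area growth `≤ C ρⁿ` on balls, which bounds all Gaussian areas uniformly by a
  layer-cake estimate); the injectivity of `dι` comes from the immersion property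
  (`Literature.Topology.FourManifolds.Manifold.IsImmersionAt.mfderiv_injective`). So the entropy
  `λ(M)` compared with `λ(𝕊³ × ℝ)`, `λ(𝕊² × ℝ²)` in the hypotheses is a finite quantity, as the
  paper's Definition 1.6 presupposes for closed hypersurfaces.
* **Unconditional thresholds.** Stone's cylinder values are now a theorem of the tree
  (`Stone1994_cylinderEntropy_holds`, `ColdingMinicozziEntropyValuesProofs.lean`), so the
  thresholds of the fact are the explicit numbers `λ(shrinkingCylinder 4 3) = Λ₃ = 2π²(3/(2πe))^{3/2}`
  and `λ(shrinkingCylinder 4 2) = 4/e` (`gaussianEntropy_shrinkingCylinder_four_three`,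
  `…_four_two`, `…_four_one`), they are strictly ordered `Λ₄ < λ(cyl 3) < λ(cyl 2) < λ(cyl 1)`
  unconditionally (`gaussianEntropy_shrinkingCylinder_four_three_lt_two`, `…_two_lt_one`,
  `gaussianEntropy_sphere_lt_shrinkingCylinder_four_three`), hypothesis (a) implies hypothesis (b)
  (`le_shrinkingCylinder_four_two_of_le_three`), and the non-vacuity witness `(𝕊⁴, incl)` needs no
  hypothesis (`ChodoshMantoulidisSchulze2025_lowEntropy_sphere_four.hypotheses_unitSphere'`).
* **`λ(ι(M)) ≥ 1` (Colding–Minicozzi 2012, Lemma 7.2 (3)).** For every nonempty `M` and `C^∞`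
  embedding `ι : M → ℝ⁵`, `1 ≤ gaussianEntropy 4 (range ι)`
  (`one_le_gaussianEntropy_range_of_isSmoothEmbedding`, from
  `Literature.Geometry.Riemannian.one_le_gaussianEntropy_range`: at small scales `ι(M)` is a
  bi-Lipschitz distortion of its tangent `4`-plane, whose Gaussian area from a point of the plane
  is `1`). Together: `1 ≤ λ(ι(M)) < ∞`.
* **Gaussian densities (Colding–Minicozzi 2012, Lemma 7.2 (3) in full).** For compact `M`:
  `F_{ι x₀, t}(ι(M)) → 1` as `t → 0⁺` for every `x₀ ∈ M`, and `F_{y₀, t}(ι(M)) → 0` for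
  `y₀ ∉ ι(M)` (`tendsto_gaussianArea_range_of_isSmoothEmbedding`,
  `tendsto_gaussianArea_range_of_notMem_range`, from
  `Literature.Geometry.Riemannian.tendsto_gaussianArea_range_nhdsGT_zero` /
  `…_of_notMem`).
* **Uniform small-scale bound and attainment of the entropy (Colding–Minicozzi 2012,
  Lemma 7.7).** For compact `M`: for every `ε > 0` there is `t₀ > 0` with
  `F_{y₀,t}(ι(M)) ≤ (1+ε)⁴ + ε` for all centres `y₀ ∈ ℝ⁵` and scales `0 < t ≤ t₀`
  (`exists_forall_gaussianArea_range_le_of_isSmoothEmbedding`), and if `λ(ι(M)) > 1` then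
  `λ(ι(M)) = F_{x₀,t₀}(ι(M))` for some `x₀ ∈ ℝ⁵`, `t₀ > 0`
  (`exists_gaussianArea_eq_gaussianEntropy_of_isSmoothEmbedding`, from
  `Literature.Geometry.Riemannian.exists_gaussianArea_eq_gaussianEntropy`).
* **The next rung (route `SmoothPoincare4/EntropyLadder`, threshold `λ(𝕊¹(√2) × ℝ³) = Λ₁`).**
  Round hyperspheres are Gaussian-thin for that threshold too
  (`gaussianEntropy_sphere_lt_shrinkingCylinder_four_one`: `Λ₄ < Λ₁`), in particular the standard
  `𝕊⁴ ⊂ ℝ⁵` in the literal inline shape of the route's items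
  (`unitSphere_inline_lt_entropyLadderThreshold`), and **every `4`-manifold diffeomorphic to `𝕊⁴`
  has a Gaussian-thin `C^∞` embedding into `ℝ⁵`** (`exists_thinEmbedding_of_nonempty_diffeomorph_sphere`,
  the inclusion precomposed with the diffeomorphism; `exists_isSmoothEmbedding_range_eq_sphere_of_nonempty_diffeomorph`)
  — the pointwise form of "SPC4 ⇒ `ThinEmbeddingExists`".
* **The perturbation step** ("a small `C^∞` graph `M'` over `M`", proof of Cor. 1.22): for a
  family `ι_s : M → ℝ⁵` jointly `C^∞` in `(s, x)` with `ι_{s₀}` a `C^∞` embedding of the compact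
  `M`, `ι_s` is a `C^∞` embedding for all `s` near `s₀`
  (`eventually_isSmoothEmbedding_of_isSmoothEmbedding[_zero]`; stability of embeddings, Hirsch
  Ch. 2 §1 Thm. 1.4, the tree's `Literature.Geometry.Manifold.eventually_isSmoothEmbedding`), so
  the perturbed hypersurface is again a closed embedded copy of `M`.
* **The round case as an explicit flow.** When `ι(M) = sphere c r ⊂ ℝ⁵`, the mean curvature
  flow of the printed proof is the tree's classical MCF of homothetically shrinking spheres about
  `c` (`roundCase_isClassicalMCF`, `ShrinkingSphereMCF.lean`: `R(t) = √(r² - 8t)`, extinct at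
  `T = r²/8`, time-`0` slice `ι(M)` — `roundCase_range_zero`), every slice is a round sphere of
  entropy `Λ₄ < λ(𝕊³ × ℝ)` (`roundCase_slice`), Huisken's density at the singular point
  `(c, r²/8)` is `Λ₄` (`roundCase_gaussianArea`), and the level set flow of `ι(M)` stays in the
  closed balls `closedBall c √(r² - 8t)` and is empty after `r²/8` (`roundCase_levelSetFlow_subset`,
  `roundCase_levelSetFlow_eq_empty`, Evans–Spruck 1991 Thm. 7.1 (a) for the tree's `levelSetFlow`,
  `LevelSetFlowExtinction.lean`); and `M ≅ 𝕊⁴` by `nonempty_diffeomorph_sphere_four_of_range_eq_sphere`.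
* **The weak (level set) flow of `ι(M)`.** The tree's level set flow `t ↦ F_t(ι(M))` (White's
  biggest weak set flow) IS a weak set flow on `[0, ∞)` (`isWeakSetFlowIn_levelSetFlow_range`, from
  `LevelSetFlowWeakSetFlow.lean`: existence of the biggest flow for closed initial sets, via the
  comparison / avoidance principle for classical flows `MCFComparisonPrinciple.lean`, translation
  invariance `MCFTranslationInvariance.lean` and the inner sphere barriers
  `LevelSetFlowInnerBarrier.lean`), with compact time slices and closed track
  (`isCompact_levelSetFlow_range`), the avoidance principle against classical flows
  (`levelSetFlow_range_avoidance`) and finite extinction (`exists_levelSetFlow_range_eq_empty`);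
  in the round case it is exactly the shrinking sphere `sphere c √(r² - 8t)`, `0 ≤ t < r²/8`
  (`roundCase_levelSetFlow_eq`, `roundCase_levelSetFlow_extinction`).

## What is NOT proved here (and why `…_holds` is absent)

The discharge `ChodoshMantoulidisSchulze2025_lowEntropy_sphere_four_holds` needs the remaining
steps of the printed proof, none of which the tree or Mathlib can presently state, let alone
prove: integral Brakke flows and the class `𝔉(M)` (Ilmanen's elliptic regularisation, White's
cyclicity), Huisken's monotonicity formula and tangent flows, Colding–Minicozzi's theory of
generic singularities and uniqueness of cylindrical tangent flows, the perturbation theorem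
Thm. 1.13 of the cited paper (built on Chodosh–Choi–Mantoulidis–Schulze, *Mean curvature flow
with generic initial data*, Invent. Math. 2024), the classification of self-shrinkers of entropy
below `λ(𝕊ⁿ⁻¹)` (Bernstein–Wang), the convergence of a flow with only a multiplicity-one
spherical singularity to a round point (Huisken 1984), and the mean curvature flow with surgery
of Daniels-Holgate (2022). Mathlib has no second fundamental form of a hypersurface, no varifolds
and no mean curvature flow (the tree now has the classical vocabulary — `meanCurvature` in
`Literature/Geometry/Lorentzian/Hypersurface.lean`, `IsClassicalMCF` / `IsWeakSetFlowIn` /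
`levelSetFlow` in `MeanConvexLevelSetFlow.lean`, inhabited by the shrinking spheres of
`ShrinkingSphereMCF.lean` with Evans–Spruck extinction in `LevelSetFlowExtinction.lean`, the
comparison / avoidance principle for classical flows in `MCFComparisonPrinciple.lean`, and the
theorem that the level set flow of a closed set is a weak set flow in
`LevelSetFlowWeakSetFlow.lean` — but none of the theorems just listed); the fact
therefore stays a named fact (D-0014), used as the explicit hypothesis
`(h : ChodoshMantoulidisSchulze2025_lowEntropy_sphere_four)`.

## The classical-MCF underpinning now PROVED in the tree (pointers)

Besides the weak-flow layer above, the following pieces of the classical theory entering the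
printed proof are theorems of the tree (all in `Literature/Geometry/Riemannian/` unless noted):
`MCFMetricEvolution.lean` (`∂ₜg = -2HK`, `∂ₜ√det g = -H²√det g`; Huisken 1984, Lemma 3.2),
`MCFAreaEvolution.lean` (`d/dt ∫ f dμ_t`, `d/dt Area(M_t) = -∫ H²`),
`HuiskenKernelIdentity.lean` and `HuiskenMonotonicity.lean` (**Huisken's monotonicity formula**
`d/dt ∫ ρ_{x₀,T} dμ_t = -∫ ρ |H - ⟪x - x₀, ν⟫/2(T-t)|² ≤ 0` for classical flows of compact
hypersurfaces; Huisken 1990, Thm. 3.1), `MCFIsometryInvariance.lean`, `MCFTranslationInvariance.lean`,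
`MCFParabolicScaling.lean` (symmetries of classical / weak / level set flows), `LevelSetFlowBalls.lean`,
`LevelSetFlowInnerBarrier.lean`, `LevelSetFlowSemigroup.lean`, `LevelSetFlowArrivalTime.lean`,
`WeakSetFlowTimeShift.lean` (exact level set flows of balls and spheres, semigroup, arrival time),
`EuclideanHypersurfaceContact.lean` (flat formulas for `K`, `H`, contact comparison),
`Lorentzian/VolumeDensityRatio.lean`, `Analysis/Calculus/JacobiFormula.lean`,
`Analysis/Calculus/MixedPartials.lean`, `Analysis/Calculus/HamiltonMinimumTrick.lean`;
and, in this fact's own vocabulary (`gaussianArea`, `gaussianEntropy` of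
`ColdingMinicozziEntropy.lean`): `EmbeddedSubmanifoldHausdorff.lean` (the area measure of an
embedded compact submanifold is `μHE[n]` on its image), `MCFEntropyMonotonicity.lean`
(**the Colding–Minicozzi entropy is non-increasing along a classical mean curvature flow**,
`λ(M_t) ≤ λ(M_a)`, [ColdingMinicozzi2012, Lemma 1.11]; Huisken's Gaussian density of a classical
flow exists and is `≤ λ(M_a)`), and Brakke's identity for classical flows
(`MCFAreaEvolution.lean`, `IsClassicalMCF.hasDerivAt_integral_testFunction`); in this file
(`section EntropyAlongFlow`): `gaussianEntropy_range_le_of_isClassicalMCF` — **the fact's entropy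
hypotheses propagate along a classical mean curvature flow in `ℝ⁵`**, and
`gaussianDensity_le_gaussianEntropy_range_of_isClassicalMCF` — all Gaussian densities of the flow
are bounded by the initial entropy; (`section AlongFlowConsequences`)
`hausdorffMeasure_range_inter_closedBall_le_of_isClassicalMCF` — uniform local area bounds along the
flow from the initial entropy, and `tendsto_gaussianArea_range_of_isClassicalMCF` — the Gaussian
density is `1` on every smooth slice (`MCFRegularPointDensity.lean`).
What is still missing for `_holds` is the weak theory: Brakke flows and the monotonicity formula
for them, Colding–Minicozzi's generic-singularity theory, [ChodoshMantoulidisSchulze2025] Thm. 1.13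
and the Daniels-Holgate surgery.

## References

* [ChodoshMantoulidisSchulze2025] O. Chodosh, C. Mantoulidis, F. Schulze, Duke Math. J. 174
  (2025), arXiv:2309.03856: Cor. 1.5, Cor. 1.22 and its proof (§1.6).
* [LeeSmoothManifolds2013] J. M. Lee, *Introduction to Smooth Manifolds*, 2nd ed., GTM 218,
  Thm. 5.29, Cor. 5.30 (restricting the codomain to an embedded submanifold), Thm. 5.31
  (uniqueness of the smooth structure of an embedded submanifold).
* [Stone1994] A. Stone, Calc. Var. PDE 2 (1994), Appendix A (densities of shrinking spheres and
  cylinders); values restated in [ChodoshMantoulidisSchulze2025], Rem. 1.9, and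
  [ColdingIlmanenMinicozziWhite2013], Introduction.
-/

noncomputable section

open Set Function Metric Module
open scoped Manifold ContDiff Topology Pointwise

namespace Literature.Geometry.Riemannian

section General

variable {E : Type*} [NormedAddCommGroup E] [InnerProductSpace ℝ E] {n : ℕ}
  [Fact (finrank ℝ E = n + 1)] {m : ℕ∞ω}
  {M : Type*} [TopologicalSpace M] [ChartedSpace (EuclideanSpace ℝ (Fin n)) M]
  [IsManifold (𝓡 n) m M]

/-- **An embedding onto the unit sphere is a diffeomorphism onto `𝕊ⁿ`.** If `e : M → E` is a
`C^m` embedding (Mathlib `Manifold.IsSmoothEmbedding`: immersion + topological embedding) of a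
manifold modelled on `ℝⁿ` into an `(n+1)`-dimensional real inner product space whose image is the
unit sphere, then `M` is `C^m`-diffeomorphic to the sphere with its standard (stereographic)
structure: the corestriction `M → 𝕊ⁿ` is a homeomorphism (an embedding onto its image), it is
`C^m` (`ContMDiff.codRestrict_sphere`), and its inverse `g` is `C^m` because `e ∘ g` is the
inclusion `𝕊ⁿ ⊆ E` and `e` is an immersion (`ContMDiff.iff_comp_isImmersion`). Lee, Cor. 5.30
and Thm. 5.31 (uniqueness of the smooth structure on an embedded submanifold).
[cite: LeeSmoothManifolds2013, Cor. 5.30 and Thm. 5.31] -/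
theorem nonempty_diffeomorph_sphere_of_range_eq_unitSphere {e : M → E}
    (he : Manifold.IsSmoothEmbedding (𝓡 n) 𝓘(ℝ, E) m e) (hrange : range e = sphere (0 : E) 1) :
    Nonempty (M ≃ₘ^m⟮𝓡 n, 𝓡 n⟯ (sphere (0 : E) 1)) := by
  have hmem : ∀ x, e x ∈ sphere (0 : E) 1 := fun x => hrange ▸ mem_range_self x
  have hsurj : Surjective (Set.codRestrict e _ hmem) := by
    rintro ⟨v, hv⟩
    rw [← hrange] at hv
    obtain ⟨x, rfl⟩ := hv
    exact ⟨x, rfl⟩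
  -- the corestriction, a homeomorphism onto the sphere
  let Φ : M ≃ₜ sphere (0 : E) 1 :=
    (he.isEmbedding.codRestrict _ hmem).toHomeomorphOfSurjective hsurj
  have hΦ : ∀ x, Φ x = Set.codRestrict e _ hmem x := fun x => rfl
  have h1 : ContMDiff (𝓡 n) (𝓡 n) m Φ := he.contMDiff.codRestrict_sphere hmem
  have h2 : ContMDiff (𝓡 n) (𝓡 n) m Φ.symm := by
    rw [ContMDiff.iff_comp_isImmersion he.isImmersion]
    refine ⟨Φ.symm.continuous, ?_⟩
    have hcomp : e ∘ Φ.symm = Subtype.val := by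
      funext v
      have h3 : (Φ (Φ.symm v) : E) = v := by rw [Φ.apply_symm_apply]
      simpa [hΦ] using h3
    rw [hcomp]
    exact contMDiff_coe_sphere
  exact ⟨{ toEquiv := Φ.toEquiv, contMDiff_toFun := h1, contMDiff_invFun := h2 }⟩

/-- **An embedding onto a round sphere is a diffeomorphism onto `𝕊ⁿ`** (any centre `c`, any
radius `r > 0`): if the `C^m` embedding `e : M → E` (`dim E = n + 1`, `M` modelled on `ℝⁿ`) has
`range e = sphere c r`, then `M ≃ₘ 𝕊ⁿ`. Reduced to the unit sphere by the affine homeomorphism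
`v ↦ r⁻¹ • (v - c)`; the smoothness of the inverse again comes from the universal property of
the immersion `e` (`ContMDiff.iff_comp_isImmersion`), its composite with the inverse being the
smooth map `v ↦ r • v + c` on `𝕊ⁿ`. Lee, Cor. 5.30 and Thm. 5.31.
[cite: LeeSmoothManifolds2013, Cor. 5.30 and Thm. 5.31] -/
theorem nonempty_diffeomorph_sphere_of_range_eq_sphere {e : M → E}
    (he : Manifold.IsSmoothEmbedding (𝓡 n) 𝓘(ℝ, E) m e) {c : E} {r : ℝ} (hr : 0 < r)
    (hrange : range e = sphere c r) :
    Nonempty (M ≃ₘ^m⟮𝓡 n, 𝓡 n⟯ (sphere (0 : E) 1)) := by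
  -- the affine homeomorphism `A v = r⁻¹ • (v - c)` maps `sphere c r` onto the unit sphere
  let A : E ≃ₜ E :=
    (Homeomorph.subRight c).trans (Homeomorph.smulOfNeZero r⁻¹ (inv_ne_zero hr.ne'))
  have hA : ∀ v, A v = r⁻¹ • (v - c) := fun v => rfl
  have hmem : ∀ x, (A ∘ e) x ∈ sphere (0 : E) 1 := by
    intro x
    have hx : e x ∈ sphere c r := hrange ▸ mem_range_self x
    rw [mem_sphere_iff_norm, sub_zero, comp_apply, hA, norm_smul, norm_inv,
      Real.norm_of_nonneg hr.le, ← dist_eq_norm, mem_sphere.1 hx, inv_mul_cancel₀ hr.ne']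
  have hsurj : Surjective (Set.codRestrict (A ∘ e) _ hmem) := by
    rintro ⟨v, hv⟩
    have hw : r • v + c ∈ range e := by
      rw [hrange, mem_sphere_iff_norm, add_sub_cancel_right, norm_smul,
        Real.norm_of_nonneg hr.le, mem_sphere_zero_iff_norm.1 hv, mul_one]
    obtain ⟨x, hx⟩ := hw
    refine ⟨x, Subtype.ext ?_⟩
    show A (e x) = v
    rw [hA, hx, add_sub_cancel_right, inv_smul_smul₀ hr.ne']
  -- the rescaled corestriction, a homeomorphism onto the unit sphere
  let Φ : M ≃ₜ sphere (0 : E) 1 :=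
    ((A.isEmbedding.comp he.isEmbedding).codRestrict _ hmem).toHomeomorphOfSurjective hsurj
  have hΦ : ∀ x, (Φ x : E) = r⁻¹ • (e x - c) := fun x => rfl
  have hAs : ContMDiff 𝓘(ℝ, E) 𝓘(ℝ, E) m (A : E → E) := by
    have : ContDiff ℝ m (fun v : E => r⁻¹ • (v - c)) := by fun_prop
    exact this.contMDiff
  have h1 : ContMDiff (𝓡 n) (𝓡 n) m Φ := (hAs.comp he.contMDiff).codRestrict_sphere hmem
  have h2 : ContMDiff (𝓡 n) (𝓡 n) m Φ.symm := by
    rw [ContMDiff.iff_comp_isImmersion he.isImmersion]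
    refine ⟨Φ.symm.continuous, ?_⟩
    have hcomp : e ∘ Φ.symm = fun v : sphere (0 : E) 1 => r • (v : E) + c := by
      funext v
      have h3 : (Φ (Φ.symm v) : E) = v := by rw [Φ.apply_symm_apply]
      rw [hΦ] at h3
      have h4 : e (Φ.symm v) - c = r • (v : E) := by
        rw [← h3, smul_inv_smul₀ hr.ne']
      show e (Φ.symm v) = r • (v : E) + c
      rw [← h4, sub_add_cancel]
    rw [hcomp]
    have hB : ContMDiff 𝓘(ℝ, E) 𝓘(ℝ, E) m (fun v : E => r • v + c) := by
      have : ContDiff ℝ m (fun v : E => r • v + c) := by fun_prop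
      exact this.contMDiff
    exact hB.comp contMDiff_coe_sphere
  exact ⟨{ toEquiv := Φ.toEquiv, contMDiff_toFun := h1, contMDiff_invFun := h2 }⟩

end General

/-- **The round case of Cor. 1.22 for hypersurfaces of `ℝ⁵`** ("either `M` is a round sphere
(in which case we are done), or …", proof of Cor. 1.22), equivalently the **isotopy-endpoint
step** of the rendering of Cor. 1.5 in `ChodoshMantoulidisSchulze2025_lowEntropy_sphere_four`:
a `C^∞` `4`-manifold `M` carrying a `C^∞` embedding `ι : M → ℝ⁵` whose image is a round sphere
`sphere c r` (`r > 0`) is diffeomorphic to the standard `𝕊⁴ ⊂ ℝ⁵` — with no entropy,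
compactness or connectedness hypothesis. (The entropy hypotheses of both conjuncts of the fact
hold in this case as well, `λ(sphere c r) = λ(𝕊⁴) < λ(𝕊³ × ℝ) < λ(𝕊² × ℝ²)` by Stone's values,
but they are not needed.) [cite: ChodoshMantoulidisSchulze2025, Cor. 1.22, proof (round case)] -/
theorem nonempty_diffeomorph_sphere_four_of_range_eq_sphere
    (M : Type*) [TopologicalSpace M] [ChartedSpace (EuclideanSpace ℝ (Fin 4)) M]
    [IsManifold (𝓡 4) ∞ M] {ι : M → EuclideanSpace ℝ (Fin 5)}
    (hι : Manifold.IsSmoothEmbedding (𝓡 4) (𝓡 5) ∞ ι) {c : EuclideanSpace ℝ (Fin 5)} {r : ℝ}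
    (hr : 0 < r) (hrange : range ι = sphere c r) :
    Nonempty (M ≃ₘ⟮𝓡 4, 𝓡 4⟯ (sphere (0 : EuclideanSpace ℝ (Fin 5)) 1)) :=
  haveI := Fact.mk (@finrank_euclideanSpace_fin ℝ _ (4 + 1))
  nonempty_diffeomorph_sphere_of_range_eq_sphere hι hr hrange

/-! ### Stone's ladder for hypersurfaces of `ℝ⁵`: `1 < Λ₄ < Λ₃ < Λ₂ < Λ₁` -/

section StoneLadder

open Real

/-- **`Λ₃ = 2π² (3/(2πe))^{3/2}`** (`≈ 1.4531`), Stone's constant of the `3`-sphere: in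
`sphereEntropy 3 = 2π^{2}/Γ(2) · (3/(2πe))^{3/2}` one has `Γ(2) = 1`, `|𝕊³| = 2π²`
(Stone 1994, Appendix A; the value `λ(𝕊³) > ⋯` of Rem. 1.9 of the cited paper).
[cite: ChodoshMantoulidisSchulze2025, Rem. 1.9] -/
theorem sphereEntropy_three :
    sphereEntropy 3 = 2 * π ^ 2 * (3 / (2 * π * exp 1)) ^ ((3 : ℝ) / 2) := by
  unfold sphereEntropy
  have h1 : (((3 : ℕ) : ℝ) + 1) / 2 = (2 : ℕ) := by norm_num
  have h2 : ((3 : ℕ) : ℝ) / 2 = (3 : ℝ) / 2 := by norm_num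
  rw [h1, h2, Real.rpow_natCast, show (((2 : ℕ) : ℝ)) = 2 by norm_num, Real.Gamma_two, div_one,
    Nat.cast_ofNat]

/-- **`Λ₄ = 32/(3e²)`** (`≈ 1.4436`), Stone's constant of the `4`-sphere:
`sphereEntropy 4 = 2π^{5/2}/Γ(5/2) · (4/(2πe))² = (8π²/3) · 4/(π²e²)` with `Γ(5/2) = (3/4)√π`,
`|𝕊⁴| = 8π²/3` (Stone 1994, Appendix A). [cite: ChodoshMantoulidisSchulze2025, Rem. 1.9] -/
theorem sphereEntropy_four : sphereEntropy 4 = 32 / (3 * exp 1 ^ 2) := by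
  unfold sphereEntropy
  have h1 : (((4 : ℕ) : ℝ) + 1) / 2 = 3 / 2 + 1 := by norm_num
  have h2 : ((4 : ℕ) : ℝ) / 2 = (2 : ℕ) := by norm_num
  have hΓ : Real.Gamma (3 / 2 + 1) = 3 / 4 * Real.sqrt π := by
    rw [Real.Gamma_add_one (by norm_num), show (3 : ℝ) / 2 = 1 / 2 + 1 by norm_num,
      Real.Gamma_add_one (by norm_num), Real.Gamma_one_half_eq]
    ring
  have hπ : π ^ ((3 : ℝ) / 2 + 1) = π ^ 2 * Real.sqrt π := by
    rw [show (3 : ℝ) / 2 + 1 = (2 : ℕ) + 1 / 2 by norm_num, Real.rpow_add Real.pi_pos,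
      Real.rpow_natCast, Real.sqrt_eq_rpow]
  have hsq : Real.sqrt π ≠ 0 := by positivity
  rw [h1, h2, Real.rpow_natCast, hΓ, hπ, Nat.cast_ofNat]
  field_simp
  ring

/-- `Λ₃² = 27π/(2e³)` (squaring removes the half-integer power). [folklore] -/
theorem sq_sphereEntropy_three : sphereEntropy 3 ^ 2 = 27 * π / (2 * exp 1 ^ 3) := by
  rw [sphereEntropy_three]
  have hx : (0 : ℝ) ≤ 3 / (2 * π * exp 1) := by positivity
  have h3 : ((3 / (2 * π * exp 1)) ^ ((3 : ℝ) / 2)) ^ 2 = (3 / (2 * π * exp 1)) ^ 3 := by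
    rw [← Real.rpow_natCast, ← Real.rpow_mul hx]
    norm_num
  rw [mul_pow, h3]
  field_simp
  ring

/-- **`Λ₃ < Λ₂`**, i.e. `λ(𝕊³) < λ(𝕊²) = 4/e` (equivalently `27π < 32e`): the self-shrinking
`𝕊³ × ℝ ⊂ ℝ⁵` has smaller entropy than `𝕊² × ℝ²` (Stone 1994; Rem. 1.9 of the cited paper:
"`λ(𝕊²) = 4/e ≈ 1.47 > ⋯ > λ(𝕊ⁿ)`"). [cite: ChodoshMantoulidisSchulze2025, Rem. 1.9] -/
theorem sphereEntropy_three_lt_sphereEntropy_two : sphereEntropy 3 < sphereEntropy 2 := by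
  have h0 : 0 ≤ sphereEntropy 2 := (sphereEntropy_pos (by norm_num)).le
  refine lt_of_pow_lt_pow_left₀ 2 h0 ?_
  rw [sq_sphereEntropy_three, sphereEntropy_two, div_pow]
  have he := Real.exp_one_gt_d9
  have hπ := Real.pi_lt_d6
  have hepos := Real.exp_pos 1
  rw [div_lt_div_iff₀ (by positivity) (by positivity)]
  have h1 : 0 < 32 * exp 1 - 27 * π := by linarith
  nlinarith [mul_pos (pow_pos hepos 2) h1, pow_pos hepos 3]

/-- **`Λ₄ < Λ₃`**, i.e. `λ(𝕊⁴) = 32/(3e²) < λ(𝕊³)` (equivalently `2048 < 243πe`): the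
shrinking `𝕊⁴` has smaller entropy than `𝕊³ × ℝ`, so the entropy bound `λ < λ(𝕊³)` of
Cor. 1.5 (a) still admits the spherical singularity (Stone 1994; Rem. 1.9 of the cited paper).
[cite: ChodoshMantoulidisSchulze2025, Rem. 1.9] -/
theorem sphereEntropy_four_lt_sphereEntropy_three : sphereEntropy 4 < sphereEntropy 3 := by
  have h0 : 0 ≤ sphereEntropy 3 := (sphereEntropy_pos (by norm_num)).le
  refine lt_of_pow_lt_pow_left₀ 2 h0 ?_
  rw [sq_sphereEntropy_three, sphereEntropy_four, div_pow]
  have he := Real.exp_one_gt_d9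
  have hπ := Real.pi_gt_d6
  have hepos := Real.exp_pos 1
  rw [div_lt_div_iff₀ (by positivity) (by positivity)]
  have h1 : (8.428 : ℝ) < π * exp 1 := by nlinarith
  nlinarith [pow_pos hepos 2, pow_pos hepos 3, pow_pos hepos 4,
    mul_pos (pow_pos hepos 3) (by linarith : (0 : ℝ) < 243 * (π * exp 1) - 2048)]

/-- **`1 < Λ₄`**, i.e. `3e² < 32`: the shrinking `𝕊⁴` has entropy above that of a hyperplane
(`λ(ℝ⁴) = 1`; Rem. 1.9 of the cited paper, "`⋯ > λ(𝕊ⁿ)`" together with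
Colding–Ilmanen–Minicozzi–White's "`> 1 = λ(ℝⁿ)`"). [cite: ColdingIlmanenMinicozziWhite2013, Introduction] -/
theorem one_lt_sphereEntropy_four : 1 < sphereEntropy 4 := by
  rw [sphereEntropy_four, one_lt_div (by positivity)]
  have he := Real.exp_one_lt_d9
  nlinarith [Real.exp_pos 1]

/-- **The `n = 4` ladder of Stone's constants**: `1 < Λ₄ < Λ₃ < Λ₂ < Λ₁`
(`λ(ℝ⁴) < λ(𝕊⁴) < λ(𝕊³ × ℝ) < λ(𝕊² × ℝ²) < λ(𝕊¹ × ℝ³)` once the entropies are identified with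
the constants), assembled from the two closed-form comparisons of
`ColdingMinicozziEntropyValues.lean` and the three above. [cite: ChodoshMantoulidisSchulze2025, Rem. 1.9] -/
theorem sphereEntropy_ladder_four :
    1 < sphereEntropy 4 ∧ sphereEntropy 4 < sphereEntropy 3 ∧
      sphereEntropy 3 < sphereEntropy 2 ∧ sphereEntropy 2 < sphereEntropy 1 :=
  ⟨one_lt_sphereEntropy_four, sphereEntropy_four_lt_sphereEntropy_three,
    sphereEntropy_three_lt_sphereEntropy_two, sphereEntropy_two_lt_sphereEntropy_one⟩

/-- Under Stone's values (named fact `Stone1994_cylinderEntropy`), **the threshold of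
Cor. 1.5 (a) lies strictly below that of Cor. 1.5 (b)** for hypersurfaces of `ℝ⁵`:
`λ(𝕊³(√6) × ℝ) < λ(𝕊²(2) × ℝ²)`, i.e.
`gaussianEntropy 4 (shrinkingCylinder 4 3) < gaussianEntropy 4 (shrinkingCylinder 4 2)`.
[cite: ChodoshMantoulidisSchulze2025, Rem. 1.9] -/
theorem Stone1994_cylinderEntropy.gaussianEntropy_shrinkingCylinder_four_three_lt
    (h : Stone1994_cylinderEntropy) :
    gaussianEntropy 4 (shrinkingCylinder 4 3) < gaussianEntropy 4 (shrinkingCylinder 4 2) := by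
  rw [h 4 3 (by norm_num) (by norm_num), h 4 2 (by norm_num) (by norm_num),
    ENNReal.ofReal_lt_ofReal_iff (sphereEntropy_pos (by norm_num))]
  exact sphereEntropy_three_lt_sphereEntropy_two

/-- Under Stone's values, **the threshold of Cor. 1.5 (b) lies strictly below the threshold
`λ(𝕊¹ × ℝ³)` of route `SmoothPoincare4/EntropyLadder`**:
`gaussianEntropy 4 (shrinkingCylinder 4 2) < gaussianEntropy 4 (shrinkingCylinder 4 1)`.
[cite: ColdingIlmanenMinicozziWhite2013, Introduction] -/
theorem Stone1994_cylinderEntropy.gaussianEntropy_shrinkingCylinder_four_two_lt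
    (h : Stone1994_cylinderEntropy) :
    gaussianEntropy 4 (shrinkingCylinder 4 2) < gaussianEntropy 4 (shrinkingCylinder 4 1) := by
  rw [h 4 2 (by norm_num) (by norm_num), h 4 1 (by norm_num) (by norm_num),
    ENNReal.ofReal_lt_ofReal_iff (sphereEntropy_pos (by norm_num))]
  exact sphereEntropy_two_lt_sphereEntropy_one

/-- Consequently (under Stone's values) **the entropy hypothesis of Cor. 1.5 (a) implies that of
Cor. 1.5 (b)** for a hypersurface `A ⊆ ℝ⁵`: `λ(A) ≤ λ(𝕊³ × ℝ) ⇒ λ(A) ≤ λ(𝕊² × ℝ²)`; in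
particular, for simply connected `M` the second conjunct of
`ChodoshMantoulidisSchulze2025_lowEntropy_sphere_four` contains the first.
[cite: ChodoshMantoulidisSchulze2025, Rem. 1.9] -/
theorem Stone1994_cylinderEntropy.le_shrinkingCylinder_four_two_of_le_three
    (h : Stone1994_cylinderEntropy) {A : Set (EuclideanSpace ℝ (Fin 5))}
    (hA : gaussianEntropy 4 A ≤ gaussianEntropy 4 (shrinkingCylinder 4 3)) :
    gaussianEntropy 4 A ≤ gaussianEntropy 4 (shrinkingCylinder 4 2) :=
  hA.trans (h.gaussianEntropy_shrinkingCylinder_four_three_lt).le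

end StoneLadder

/-! ### The round sphere: entropy `Λ_k`, the inclusion as an embedding, non-vacuity -/

section RoundSphere

variable {V : Type*} [NormedAddCommGroup V] [InnerProductSpace ℝ V] [FiniteDimensional ℝ V]
  [MeasurableSpace V] [BorelSpace V]

/-- **Every round `k`-sphere has entropy `Λ_k`** (`k ≥ 1`, any centre `c`, any radius `r > 0`,
in any `(k+1)`-dimensional real inner product space), unconditionally: translate and dilate to
the self-shrinking sphere `S^k_{√(2k)}` (`gaussianEntropy_vadd`, `gaussianEntropy_smul`,
Colding–Minicozzi 2012, p. 760) whose entropy is `Λ_k` (`gaussianEntropy_shrinkingSphere`,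
Colding–Minicozzi 2012, Lemma 7.10, with Stone's computation). This is the unconditional form
of `Stone1994_cylinderEntropy.sphere_of_pos`. [cite: ColdingMinicozzi2012, Lemma 7.10] -/
theorem gaussianEntropy_sphere_of_pos {k : ℕ} (hV : finrank ℝ V = k + 1) (hk : 0 < k) (c : V)
    {r : ℝ} (hr : 0 < r) : gaussianEntropy k (sphere c r) = ENNReal.ofReal (sphereEntropy k) := by
  have hk' : (0 : ℝ) < k := by exact_mod_cast hk
  have hn' : (0 : ℝ) < Real.sqrt (2 * k) := Real.sqrt_pos.2 (by positivity)
  have hρ : r / Real.sqrt (2 * k) ≠ 0 := (div_pos hr hn').ne'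
  have hs : sphere c r = c +ᵥ ((r / Real.sqrt (2 * k)) • sphere (0 : V) (Real.sqrt (2 * k))) := by
    rw [smul_sphere' hρ, smul_zero, Real.norm_eq_abs, abs_of_pos (div_pos hr hn'),
      div_mul_cancel₀ _ hn'.ne', Metric.vadd_sphere, vadd_eq_add, add_zero]
  rw [hs, gaussianEntropy_vadd, gaussianEntropy_smul hρ, gaussianEntropy_shrinkingSphere hV hk]

/-- **Round hyperspheres of `ℝ⁵` have entropy `λ(𝕊⁴) = 32/(3e²)`** (`≈ 1.4436`), any centre,
any radius. [cite: ColdingMinicozzi2012, Lemma 7.10] -/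
theorem gaussianEntropy_sphere_four (c : EuclideanSpace ℝ (Fin 5)) {r : ℝ} (hr : 0 < r) :
    gaussianEntropy 4 (sphere c r) = ENNReal.ofReal (32 / (3 * Real.exp 1 ^ 2)) := by
  rw [← sphereEntropy_four]
  exact gaussianEntropy_sphere_of_pos (by rw [finrank_euclideanSpace_fin]) (by norm_num) c hr

/-- Under Stone's cylinder values, **round hyperspheres of `ℝ⁵` lie strictly below the
threshold of Cor. 1.5 (a)**: `λ(sphere c r) = Λ₄ < Λ₃ = λ(𝕊³(√6) × ℝ)`.
[cite: ChodoshMantoulidisSchulze2025, Rem. 1.9] -/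
theorem Stone1994_cylinderEntropy.sphere_lt_shrinkingCylinder_four_three
    (h : Stone1994_cylinderEntropy) (c : EuclideanSpace ℝ (Fin 5)) {r : ℝ} (hr : 0 < r) :
    gaussianEntropy 4 (Metric.sphere c r) < gaussianEntropy 4 (shrinkingCylinder 4 3) := by
  rw [gaussianEntropy_sphere_of_pos (by rw [finrank_euclideanSpace_fin]) (by norm_num) c hr,
    h 4 3 (by norm_num) (by norm_num),
    ENNReal.ofReal_lt_ofReal_iff (sphereEntropy_pos (by norm_num))]
  exact sphereEntropy_four_lt_sphereEntropy_three

/-- **The inclusion `𝕊ⁿ ⊆ ℝⁿ⁺¹` is a `C^∞` embedding** in Mathlib's chart sense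
(`Manifold.IsSmoothEmbedding`): it is `C^∞` (`contMDiff_coe_sphere`), injective, with injective
differential (`mfderiv_coe_sphere_injective`), on a compact manifold — so the tree's immersion
criterion `Literature.Topology.FourManifolds.isSmoothEmbedding_of_injective_of_injective_mfderiv`
applies (Hirsch, *Differential Topology*, Ch. 1 §3, Thm. 3.1). [folklore] -/
theorem isSmoothEmbedding_subtypeVal_sphere (n : ℕ) :
    Manifold.IsSmoothEmbedding (𝓡 n) (𝓡 (n + 1)) ∞
      (Subtype.val : sphere (0 : EuclideanSpace ℝ (Fin (n + 1))) 1 → EuclideanSpace ℝ (Fin (n + 1))) :=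
  haveI := Fact.mk (@finrank_euclideanSpace_fin ℝ _ (n + 1))
  Literature.Topology.FourManifolds.isSmoothEmbedding_of_injective_of_injective_mfderiv
    (contMDiff_coe_sphere (n := n)) (by simp) Subtype.val_injective
    fun v => mfderiv_coe_sphere_injective v

/-- **Non-vacuity of `ChodoshMantoulidisSchulze2025_lowEntropy_sphere_four`.** Granted Stone's
cylinder values, the standard sphere `M = 𝕊⁴` with `ι` the inclusion satisfies every hypothesis
of both conjuncts, with strict entropy inequalities: `ι` is a `C^∞` embedding, `𝕊⁴` is simply
connected (`Literature.AlgebraicTopology.FundamentalGroup.simplyConnectedSpace_euclideanSphere`),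
and `λ(ι(𝕊⁴)) = Λ₄ < λ(𝕊³(√6) × ℝ) < λ(𝕊²(2) × ℝ²)`; the conclusion holds there by
`Diffeomorph.refl`. (Compactness, Hausdorffness, second countability and connectedness of `𝕊⁴`
are Mathlib instances or standard.) [cite: ChodoshMantoulidisSchulze2025, Cor. 1.22, proof (round case)] -/
theorem ChodoshMantoulidisSchulze2025_lowEntropy_sphere_four.hypotheses_unitSphere
    (h : Stone1994_cylinderEntropy) :
    Manifold.IsSmoothEmbedding (𝓡 4) (𝓡 5) ∞
        (Subtype.val : Metric.sphere (0 : EuclideanSpace ℝ (Fin 5)) 1 → EuclideanSpace ℝ (Fin 5)) ∧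
      SimplyConnectedSpace (Metric.sphere (0 : EuclideanSpace ℝ (Fin 5)) 1) ∧
      gaussianEntropy 4 (range (Subtype.val : Metric.sphere (0 : EuclideanSpace ℝ (Fin 5)) 1 →
          EuclideanSpace ℝ (Fin 5))) < gaussianEntropy 4 (shrinkingCylinder 4 3) ∧
      gaussianEntropy 4 (range (Subtype.val : Metric.sphere (0 : EuclideanSpace ℝ (Fin 5)) 1 →
          EuclideanSpace ℝ (Fin 5))) < gaussianEntropy 4 (shrinkingCylinder 4 2) ∧
      Nonempty ((Metric.sphere (0 : EuclideanSpace ℝ (Fin 5)) 1) ≃ₘ⟮𝓡 4, 𝓡 4⟯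
        (Metric.sphere (0 : EuclideanSpace ℝ (Fin 5)) 1)) := by
  have h3 : gaussianEntropy 4 (Metric.sphere (0 : EuclideanSpace ℝ (Fin 5)) 1) <
      gaussianEntropy 4 (shrinkingCylinder 4 3) :=
    h.sphere_lt_shrinkingCylinder_four_three 0 one_pos
  refine ⟨isSmoothEmbedding_subtypeVal_sphere 4,
    Literature.AlgebraicTopology.FundamentalGroup.simplyConnectedSpace_euclideanSphere 4
      (by norm_num), ?_, ?_, ⟨Diffeomorph.refl _ _ _⟩⟩
  · rwa [Subtype.range_coe]
  · rw [Subtype.range_coe]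
    exact h3.trans (h.gaussianEntropy_shrinkingCylinder_four_three_lt)

end RoundSphere

/-! ### Finiteness of the area and of the entropy of `ι(M)` -/

section Finite

open _root_.MeasureTheory _root_.MeasureTheory.Measure

/-- **A closed embedded hypersurface of `ℝ⁵` has finite area**: for a compact `C^∞` `4`-manifold
`M` and a `C^∞` embedding `ι : M → ℝ⁵` (indeed any `C¹` map), `μHE[4] (range ι) < ∞`
(`Literature.MeasureTheory.Hausdorff.euclideanHausdorffMeasure_range_lt_top`: `C¹` images of
compact manifolds have finite Hausdorff measure in the dimension of the model; Federer 2.10.11).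
[cite: ColdingMinicozzi2012, Lemma 7.2] -/
theorem euclideanHausdorffMeasure_range_lt_top_of_isSmoothEmbedding
    (M : Type*) [TopologicalSpace M] [CompactSpace M] [ChartedSpace (EuclideanSpace ℝ (Fin 4)) M]
    {ι : M → EuclideanSpace ℝ (Fin 5)} (hι : Manifold.IsSmoothEmbedding (𝓡 4) (𝓡 5) ∞ ι) :
    (μHE[4] : Measure (EuclideanSpace ℝ (Fin 5))) (range ι) < ⊤ :=
  Literature.MeasureTheory.Hausdorff.euclideanHausdorffMeasure_range_lt_top hι.contMDiff
    (by simp) (by rw [finrank_euclideanSpace_fin])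

/-- **A closed embedded hypersurface of `ℝ⁵` has finite Colding–Minicozzi entropy**
(Colding–Minicozzi 2012, Lemma 7.2: `λ(Σ) < ∞` for a closed hypersurface): for a compact
`C^∞` `4`-manifold `M` and a `C^∞` embedding `ι : M → ℝ⁵`, `gaussianEntropy 4 (range ι) < ∞`.
The differential of `ι` is injective (`ι` is an immersion,
`Literature.Topology.FourManifolds.Manifold.IsImmersionAt.mfderiv_injective`), so `ι(M)` has area
growth `≤ C ρ⁴` on balls and `Literature.Geometry.Riemannian.gaussianEntropy_range_lt_top`
applies. In particular the entropies compared in both conjuncts of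
`ChodoshMantoulidisSchulze2025_lowEntropy_sphere_four` are finite on the left-hand side.
[cite: ColdingMinicozzi2012, Lemma 7.2] -/
theorem gaussianEntropy_range_lt_top_of_isSmoothEmbedding
    (M : Type*) [TopologicalSpace M] [CompactSpace M] [ChartedSpace (EuclideanSpace ℝ (Fin 4)) M]
    [IsManifold (𝓡 4) ∞ M] {ι : M → EuclideanSpace ℝ (Fin 5)}
    (hι : Manifold.IsSmoothEmbedding (𝓡 4) (𝓡 5) ∞ ι) :
    gaussianEntropy 4 (range ι) < ⊤ :=
  gaussianEntropy_range_lt_top_of_contMDiff (EM := EuclideanSpace ℝ (Fin 4))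
    finrank_euclideanSpace_fin hι.contMDiff (by simp)
    fun x => Literature.Topology.FourManifolds.Manifold.IsImmersionAt.mfderiv_injective
      (hι.isImmersion.isImmersionAt x) (by simp)

/-- The entropy of `ι(M)` as a real number: `λ(ι(M)) = ENNReal.ofReal r` for some `r ≥ 0`
(finiteness, `gaussianEntropy_range_lt_top_of_isSmoothEmbedding`). [cite: ColdingMinicozzi2012, Lemma 7.2] -/
theorem exists_gaussianEntropy_range_eq_ofReal
    (M : Type*) [TopologicalSpace M] [CompactSpace M] [ChartedSpace (EuclideanSpace ℝ (Fin 4)) M]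
    [IsManifold (𝓡 4) ∞ M] {ι : M → EuclideanSpace ℝ (Fin 5)}
    (hι : Manifold.IsSmoothEmbedding (𝓡 4) (𝓡 5) ∞ ι) :
    ∃ r : ℝ, 0 ≤ r ∧ gaussianEntropy 4 (range ι) = ENNReal.ofReal r :=
  ⟨(gaussianEntropy 4 (range ι)).toReal, ENNReal.toReal_nonneg,
    (ENNReal.ofReal_toReal (gaussianEntropy_range_lt_top_of_isSmoothEmbedding M hι).ne).symm⟩

/-- **A closed embedded hypersurface of `ℝ⁵` has entropy at least `1`** (Colding–Minicozzi
2012, Lemma 7.2 (3): `F_{x₀,t₀}(Σ) → 1` as `t₀ → 0` for `x₀ ∈ Σ`): for a nonempty `C^∞`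
`4`-manifold `M` and a `C^∞` embedding `ι : M → ℝ⁵` (compactness is not needed),
`1 ≤ gaussianEntropy 4 (range ι)` — `ι` has injective differential
(`Literature.Topology.FourManifolds.Manifold.IsImmersionAt.mfderiv_injective`) and
`Literature.Geometry.Riemannian.one_le_gaussianEntropy_range` applies.
[cite: ColdingMinicozzi2012, Lemma 7.2] -/
theorem one_le_gaussianEntropy_range_of_isSmoothEmbedding
    (M : Type*) [TopologicalSpace M] [Nonempty M] [ChartedSpace (EuclideanSpace ℝ (Fin 4)) M]
    [IsManifold (𝓡 4) ∞ M] {ι : M → EuclideanSpace ℝ (Fin 5)}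
    (hι : Manifold.IsSmoothEmbedding (𝓡 4) (𝓡 5) ∞ ι) :
    1 ≤ gaussianEntropy 4 (range ι) :=
  one_le_gaussianEntropy_range (EM := EuclideanSpace ℝ (Fin 4)) finrank_euclideanSpace_fin
    (Classical.arbitrary M) (hι.contMDiff.of_le (by simp)).contMDiffAt
    (Literature.Topology.FourManifolds.Manifold.IsImmersionAt.mfderiv_injective
      (hι.isImmersion.isImmersionAt _) (by simp))

/-- **`1 ≤ λ(ι(M)) < ∞` for every `(M, ι)` as in the fact** (compact nonempty `C^∞` `4`-manifold,
`C^∞` embedding into `ℝ⁵`): the entropies compared with Stone's thresholds in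
`ChodoshMantoulidisSchulze2025_lowEntropy_sphere_four` are genuine numbers in `[1, ∞)`
(Colding–Minicozzi 2012, Lemma 7.2 (3)–(4)). [cite: ColdingMinicozzi2012, Lemma 7.2] -/
theorem one_le_gaussianEntropy_range_and_lt_top_of_isSmoothEmbedding
    (M : Type*) [TopologicalSpace M] [CompactSpace M] [Nonempty M]
    [ChartedSpace (EuclideanSpace ℝ (Fin 4)) M] [IsManifold (𝓡 4) ∞ M]
    {ι : M → EuclideanSpace ℝ (Fin 5)} (hι : Manifold.IsSmoothEmbedding (𝓡 4) (𝓡 5) ∞ ι) :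
    1 ≤ gaussianEntropy 4 (range ι) ∧ gaussianEntropy 4 (range ι) < ⊤ :=
  ⟨one_le_gaussianEntropy_range_of_isSmoothEmbedding M hι,
    gaussianEntropy_range_lt_top_of_isSmoothEmbedding M hι⟩

/-- **Colding–Minicozzi 2012, Lemma 7.2 (3) for the fact's hypersurfaces, `x₀ ∈ Σ`**: for a
compact `C^∞` `4`-manifold `M`, a `C^∞` embedding `ι : M → ℝ⁵` and `x₀ ∈ M`, the Gaussian
areas `F_{ι x₀, t}(ι(M))` tend to `1` as `t → 0⁺`. [cite: ColdingMinicozzi2012, Lemma 7.2] -/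
theorem tendsto_gaussianArea_range_of_isSmoothEmbedding
    (M : Type*) [TopologicalSpace M] [CompactSpace M] [ChartedSpace (EuclideanSpace ℝ (Fin 4)) M]
    [IsManifold (𝓡 4) ∞ M] {ι : M → EuclideanSpace ℝ (Fin 5)}
    (hι : Manifold.IsSmoothEmbedding (𝓡 4) (𝓡 5) ∞ ι) (x₀ : M) :
    Filter.Tendsto (fun t : ℝ => gaussianArea 4 (ι x₀) t (range ι)) (𝓝[>] 0) (𝓝 1) :=
  tendsto_gaussianArea_range_nhdsGT_zero (EM := EuclideanSpace ℝ (Fin 4))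
    finrank_euclideanSpace_fin hι.contMDiff (by simp) hι.isEmbedding.injective x₀
    (Literature.Topology.FourManifolds.Manifold.IsImmersionAt.mfderiv_injective
      (hι.isImmersion.isImmersionAt x₀) (by simp))

/-- **Colding–Minicozzi 2012, Lemma 7.2 (3) for the fact's hypersurfaces, `y₀ ∉ Σ`**: the
Gaussian areas `F_{y₀, t}(ι(M))` tend to `0` as `t → 0⁺`. [cite: ColdingMinicozzi2012, Lemma 7.2] -/
theorem tendsto_gaussianArea_range_of_notMem_range
    (M : Type*) [TopologicalSpace M] [CompactSpace M] [ChartedSpace (EuclideanSpace ℝ (Fin 4)) M]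
    {ι : M → EuclideanSpace ℝ (Fin 5)} (hι : Manifold.IsSmoothEmbedding (𝓡 4) (𝓡 5) ∞ ι)
    {y₀ : EuclideanSpace ℝ (Fin 5)} (hy : y₀ ∉ range ι) :
    Filter.Tendsto (fun t : ℝ => gaussianArea 4 y₀ t (range ι)) (𝓝[>] 0) (𝓝 0) :=
  tendsto_gaussianArea_range_of_notMem (EM := EuclideanSpace ℝ (Fin 4)) (I := 𝓡 4)
    finrank_euclideanSpace_fin hι.contMDiff (by simp) hy

/-- **Uniform small-scale bound** (Colding–Minicozzi 2012, proof of Lemma 7.7) for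
the fact's hypersurfaces: for a compact `C^∞` `4`-manifold `M`, a `C^∞` embedding `ι : M → ℝ⁵`
and `ε > 0`, there is `t₀ > 0` with `F_{y₀,t}(ι(M)) ≤ (1+ε)⁴ + ε` for every centre `y₀` and
every scale `0 < t ≤ t₀`. [cite: ColdingMinicozzi2012, Lemma 7.7] -/
theorem exists_forall_gaussianArea_range_le_of_isSmoothEmbedding
    (M : Type*) [TopologicalSpace M] [CompactSpace M] [ChartedSpace (EuclideanSpace ℝ (Fin 4)) M]
    [IsManifold (𝓡 4) ∞ M] {ι : M → EuclideanSpace ℝ (Fin 5)}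
    (hι : Manifold.IsSmoothEmbedding (𝓡 4) (𝓡 5) ∞ ι) {ε : ℝ} (hε : 0 < ε) :
    ∃ t₀ : ℝ, 0 < t₀ ∧ ∀ (y₀ : EuclideanSpace ℝ (Fin 5)) (t : ℝ), 0 < t → t ≤ t₀ →
      gaussianArea 4 y₀ t (range ι) ≤ ENNReal.ofReal ((1 + ε) ^ 4) + ENNReal.ofReal ε :=
  exists_forall_gaussianArea_range_le (EM := EuclideanSpace ℝ (Fin 4))
    finrank_euclideanSpace_fin hι.contMDiff (by simp) hι.isEmbedding.injective
    (fun x => Literature.Topology.FourManifolds.Manifold.IsImmersionAt.mfderiv_injective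
      (hι.isImmersion.isImmersionAt x) (by simp)) hε

/-- **Colding–Minicozzi 2012, Lemma 7.7, for the fact's hypersurfaces: the entropy is achieved
when `λ > 1`.** For a compact `C^∞` `4`-manifold `M` and a `C^∞` embedding `ι : M → ℝ⁵` with
`λ(ι(M)) > 1` there are `x₀ ∈ ℝ⁵` and `t₀ > 0` with `λ(ι(M)) = F_{x₀,t₀}(ι(M))`.
[cite: ColdingMinicozzi2012, Lemma 7.7] -/
theorem exists_gaussianArea_eq_gaussianEntropy_of_isSmoothEmbedding
    (M : Type*) [TopologicalSpace M] [CompactSpace M] [ChartedSpace (EuclideanSpace ℝ (Fin 4)) M]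
    [IsManifold (𝓡 4) ∞ M] {ι : M → EuclideanSpace ℝ (Fin 5)}
    (hι : Manifold.IsSmoothEmbedding (𝓡 4) (𝓡 5) ∞ ι) (hent : 1 < gaussianEntropy 4 (range ι)) :
    ∃ (x₀ : EuclideanSpace ℝ (Fin 5)) (t₀ : ℝ), 0 < t₀ ∧
      gaussianArea 4 x₀ t₀ (range ι) = gaussianEntropy 4 (range ι) :=
  exists_gaussianArea_eq_gaussianEntropy (EM := EuclideanSpace ℝ (Fin 4))
    finrank_euclideanSpace_fin (by norm_num) hι.contMDiff (by simp) hι.isEmbedding.injective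
    (fun x => Literature.Topology.FourManifolds.Manifold.IsImmersionAt.mfderiv_injective
      (hι.isImmersion.isImmersionAt x) (by simp)) hent

end Finite

/-! ### Unconditional thresholds (Stone's values are now proved in the tree) -/

section Unconditional

/-- **`λ(𝕊³(√6) × ℝ) = Λ₃ = 2π² (3/(2πe))^{3/2}`** (`≈ 1.4531`), the threshold of Cor. 1.5 (a) for
`n = 4`, unconditionally (Stone's values, `Stone1994_cylinderEntropy_holds`).
[cite: ChodoshMantoulidisSchulze2025, Rem. 1.9] -/
theorem gaussianEntropy_shrinkingCylinder_four_three :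
    gaussianEntropy 4 (shrinkingCylinder 4 3) =
      ENNReal.ofReal (2 * Real.pi ^ 2 * (3 / (2 * Real.pi * Real.exp 1)) ^ ((3 : ℝ) / 2)) := by
  rw [Stone1994_cylinderEntropy_holds 4 3 (by norm_num) (by norm_num), sphereEntropy_three]

/-- **`λ(𝕊²(2) × ℝ²) = Λ₂ = 4/e`** (`≈ 1.4715`), the threshold of Cor. 1.5 (b) for `n = 4`,
unconditionally. [cite: ChodoshMantoulidisSchulze2025, Rem. 1.9] -/
theorem gaussianEntropy_shrinkingCylinder_four_two :
    gaussianEntropy 4 (shrinkingCylinder 4 2) = ENNReal.ofReal (4 / Real.exp 1) := by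
  rw [Stone1994_cylinderEntropy_holds 4 2 (by norm_num) (by norm_num), sphereEntropy_two]

/-- **`λ(𝕊¹(√2) × ℝ³) = Λ₁ = √(2π/e)`** (`≈ 1.5203`), the threshold of route
`SmoothPoincare4/EntropyLadder`, unconditionally. [cite: ChodoshMantoulidisSchulze2025, Rem. 1.9] -/
theorem gaussianEntropy_shrinkingCylinder_four_one :
    gaussianEntropy 4 (shrinkingCylinder 4 1) = ENNReal.ofReal (Real.sqrt (2 * Real.pi / Real.exp 1)) := by
  rw [Stone1994_cylinderEntropy_holds 4 1 (by norm_num) (by norm_num), sphereEntropy_one]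

/-- The thresholds of Cor. 1.5 (a) and (b) for `n = 4` are strictly ordered:
`λ(𝕊³(√6) × ℝ) < λ(𝕊²(2) × ℝ²)`, unconditionally. [cite: ChodoshMantoulidisSchulze2025, Rem. 1.9] -/
theorem gaussianEntropy_shrinkingCylinder_four_three_lt_two :
    gaussianEntropy 4 (shrinkingCylinder 4 3) < gaussianEntropy 4 (shrinkingCylinder 4 2) :=
  Stone1994_cylinderEntropy_holds.gaussianEntropy_shrinkingCylinder_four_three_lt

/-- `λ(𝕊²(2) × ℝ²) < λ(𝕊¹(√2) × ℝ³)`, unconditionally: Cor. 1.5 (b) sits one rung below the route's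
threshold. [cite: ColdingIlmanenMinicozziWhite2013, Introduction] -/
theorem gaussianEntropy_shrinkingCylinder_four_two_lt_one :
    gaussianEntropy 4 (shrinkingCylinder 4 2) < gaussianEntropy 4 (shrinkingCylinder 4 1) :=
  Stone1994_cylinderEntropy_holds.gaussianEntropy_shrinkingCylinder_four_two_lt

/-- **The entropy hypothesis of Cor. 1.5 (a) implies that of Cor. 1.5 (b)**, unconditionally; so
for simply connected `M` the second conjunct of the fact contains the first.
[cite: ChodoshMantoulidisSchulze2025, Rem. 1.9] -/
theorem le_shrinkingCylinder_four_two_of_le_three {A : Set (EuclideanSpace ℝ (Fin 5))}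
    (hA : gaussianEntropy 4 A ≤ gaussianEntropy 4 (shrinkingCylinder 4 3)) :
    gaussianEntropy 4 A ≤ gaussianEntropy 4 (shrinkingCylinder 4 2) :=
  Stone1994_cylinderEntropy_holds.le_shrinkingCylinder_four_two_of_le_three hA

/-- **Round hyperspheres of `ℝ⁵` lie strictly below the threshold of Cor. 1.5 (a)**,
unconditionally: `λ(sphere c r) = Λ₄ < Λ₃ = λ(𝕊³(√6) × ℝ)`. [cite: ChodoshMantoulidisSchulze2025, Rem. 1.9] -/
theorem gaussianEntropy_sphere_lt_shrinkingCylinder_four_three (c : EuclideanSpace ℝ (Fin 5))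
    {r : ℝ} (hr : 0 < r) :
    gaussianEntropy 4 (Metric.sphere c r) < gaussianEntropy 4 (shrinkingCylinder 4 3) :=
  Stone1994_cylinderEntropy_holds.sphere_lt_shrinkingCylinder_four_three c hr

/-- **Non-vacuity of `ChodoshMantoulidisSchulze2025_lowEntropy_sphere_four`, unconditionally**:
`(M, ι) = (𝕊⁴, incl)` satisfies every hypothesis of both conjuncts with strict entropy
inequalities, and the conclusion. [cite: ChodoshMantoulidisSchulze2025, Cor. 1.22, proof (round case)] -/
theorem ChodoshMantoulidisSchulze2025_lowEntropy_sphere_four.hypotheses_unitSphere' :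
    Manifold.IsSmoothEmbedding (𝓡 4) (𝓡 5) ∞
        (Subtype.val : Metric.sphere (0 : EuclideanSpace ℝ (Fin 5)) 1 → EuclideanSpace ℝ (Fin 5)) ∧
      SimplyConnectedSpace (Metric.sphere (0 : EuclideanSpace ℝ (Fin 5)) 1) ∧
      gaussianEntropy 4 (range (Subtype.val : Metric.sphere (0 : EuclideanSpace ℝ (Fin 5)) 1 →
          EuclideanSpace ℝ (Fin 5))) < gaussianEntropy 4 (shrinkingCylinder 4 3) ∧
      gaussianEntropy 4 (range (Subtype.val : Metric.sphere (0 : EuclideanSpace ℝ (Fin 5)) 1 →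
          EuclideanSpace ℝ (Fin 5))) < gaussianEntropy 4 (shrinkingCylinder 4 2) ∧
      Nonempty ((Metric.sphere (0 : EuclideanSpace ℝ (Fin 5)) 1) ≃ₘ⟮𝓡 4, 𝓡 4⟯
        (Metric.sphere (0 : EuclideanSpace ℝ (Fin 5)) 1)) :=
  ChodoshMantoulidisSchulze2025_lowEntropy_sphere_four.hypotheses_unitSphere
    Stone1994_cylinderEntropy_holds

end Unconditional

/-! ### The next rung: round spheres are Gaussian-thin for the threshold `λ(𝕊¹(√2) × ℝ³)` of
route `SmoothPoincare4/EntropyLadder` (its items `ThinEmbeddingExists`, `ThinSpheresStandard`) -/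

section EntropyLadderRung

open _root_.MeasureTheory _root_.MeasureTheory.Measure

/-- **Round hyperspheres of `ℝ⁵` lie strictly below the route's threshold**, unconditionally:
`λ(sphere c r) = Λ₄ < Λ₃ < Λ₂ < Λ₁ = λ(𝕊¹(√2) × ℝ³)` (Stone's ladder, CMS Rem. 1.9).
[cite: ChodoshMantoulidisSchulze2025, Rem. 1.9] -/
theorem gaussianEntropy_sphere_lt_shrinkingCylinder_four_one (c : EuclideanSpace ℝ (Fin 5))
    {r : ℝ} (hr : 0 < r) :
    gaussianEntropy 4 (Metric.sphere c r) < gaussianEntropy 4 (shrinkingCylinder 4 1) :=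
  ((gaussianEntropy_sphere_lt_shrinkingCylinder_four_three c hr).trans
    gaussianEntropy_shrinkingCylinder_four_three_lt_two).trans
    gaussianEntropy_shrinkingCylinder_four_two_lt_one

/-- **The standard `𝕊⁴ ⊂ ℝ⁵` is Gaussian-thin in the literal inline shape of the route's items**
(`ent(range ι) < ent({y | y₀² + y₁² = 2})` with the un-normalised `μH[4]` functional), for
`ι` the inclusion: non-vacuity of the hypotheses of `ThinSpheresStandard` /
`ThinSpheresBoundTwoHandlebodies`, unconditionally. [cite: ChodoshMantoulidisSchulze2025, Rem. 1.9] -/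
theorem unitSphere_inline_lt_entropyLadderThreshold :
    (⨆ (p : EuclideanSpace ℝ (Fin 5)) (t : ℝ) (_ : 0 < t),
        (ENNReal.ofReal (t ^ 2))⁻¹ *
          ∫⁻ x in range (Subtype.val : Metric.sphere (0 : EuclideanSpace ℝ (Fin 5)) 1 →
              EuclideanSpace ℝ (Fin 5)),
            ENNReal.ofReal (Real.exp (-(‖x - p‖ ^ 2) / (4 * t))) ∂μH[4]) <
      ⨆ (p : EuclideanSpace ℝ (Fin 5)) (t : ℝ) (_ : 0 < t),
        (ENNReal.ofReal (t ^ 2))⁻¹ *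
          ∫⁻ x in {y : EuclideanSpace ℝ (Fin 5) | y 0 ^ 2 + y 1 ^ 2 = 2},
            ENNReal.ofReal (Real.exp (-(‖x - p‖ ^ 2) / (4 * t))) ∂μH[4] := by
  rw [← gaussianEntropy_four_lt_iff, Subtype.range_coe, ← shrinkingCylinder_four_one]
  exact gaussianEntropy_sphere_lt_shrinkingCylinder_four_one 0 one_pos

/-- **Every `4`-manifold diffeomorphic to `𝕊⁴` embeds onto the unit sphere of `ℝ⁵`**: the
inclusion precomposed with the diffeomorphism is a `C^∞` embedding (injective, injective
differential, compact source — Hirsch's criterion `isSmoothEmbedding_of_injective_of_injective_mfderiv`)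
with image the unit sphere. [folklore] -/
theorem exists_isSmoothEmbedding_range_eq_sphere_of_nonempty_diffeomorph (M : Type*)
    [TopologicalSpace M] [ChartedSpace (EuclideanSpace ℝ (Fin 4)) M] [IsManifold (𝓡 4) ∞ M]
    (hM : Nonempty (M ≃ₘ⟮𝓡 4, 𝓡 4⟯ Metric.sphere (0 : EuclideanSpace ℝ (Fin 5)) 1)) :
    ∃ ι : M → EuclideanSpace ℝ (Fin 5), Manifold.IsSmoothEmbedding (𝓡 4) (𝓡 5) ∞ ι ∧
      range ι = Metric.sphere (0 : EuclideanSpace ℝ (Fin 5)) 1 := by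
  obtain ⟨Φ⟩ := hM
  refine ⟨Subtype.val ∘ Φ, ?_, ?_⟩
  · haveI : CompactSpace M := Φ.symm.toHomeomorph.compactSpace
    haveI := Fact.mk (@finrank_euclideanSpace_fin ℝ _ (4 + 1))
    refine Literature.Topology.FourManifolds.isSmoothEmbedding_of_injective_of_injective_mfderiv
      ((contMDiff_coe_sphere (n := 4)).comp Φ.contMDiff) (by simp)
      (Subtype.val_injective.comp Φ.injective) fun x => ?_
    have hΦ : MDifferentiableAt (𝓡 4) (𝓡 4) Φ x := Φ.contMDiff.mdifferentiableAt (by simp)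
    have hvalC : ContMDiff (𝓡 4) (𝓡 5) ∞
        (Subtype.val : Metric.sphere (0 : EuclideanSpace ℝ (Fin 5)) 1 → EuclideanSpace ℝ (Fin 5)) :=
      contMDiff_coe_sphere (n := 4)
    have hval : MDifferentiableAt (𝓡 4) (𝓡 5)
        (Subtype.val : Metric.sphere (0 : EuclideanSpace ℝ (Fin 5)) 1 → EuclideanSpace ℝ (Fin 5))
        (Φ x) :=
      hvalC.mdifferentiableAt (by simp)
    rw [mfderiv_comp x hval hΦ]
    have hinjΦ : Injective (mfderiv (𝓡 4) (𝓡 4) Φ x) :=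
      (Φ.toOpenPartialHomeomorph_mdifferentiable (by simp)).mfderiv_injective (x := x) (by simp)
    exact (mfderiv_coe_sphere_injective (n := 4) (Φ x)).comp hinjΦ
  · have hs : Surjective (Φ : M → Metric.sphere (0 : EuclideanSpace ℝ (Fin 5)) 1) := Φ.surjective
    rw [range_comp, hs.range_eq, image_univ, Subtype.range_coe]

/-- **`SmoothPoincare4 ⇒ ThinEmbeddingExists`, pointwise, in the tree's vocabulary**: every
`4`-manifold diffeomorphic to `𝕊⁴` has a `C^∞` embedding into `ℝ⁵` with
`λ(ι(M)) = Λ₄ < λ(𝕊¹(√2) × ℝ³)`. [cite: ChodoshMantoulidisSchulze2025, Rem. 1.9] -/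
theorem exists_isSmoothEmbedding_gaussianEntropy_lt_shrinkingCylinder_four_one (M : Type*)
    [TopologicalSpace M] [ChartedSpace (EuclideanSpace ℝ (Fin 4)) M] [IsManifold (𝓡 4) ∞ M]
    (hM : Nonempty (M ≃ₘ⟮𝓡 4, 𝓡 4⟯ Metric.sphere (0 : EuclideanSpace ℝ (Fin 5)) 1)) :
    ∃ ι : M → EuclideanSpace ℝ (Fin 5), Manifold.IsSmoothEmbedding (𝓡 4) (𝓡 5) ∞ ι ∧
      range ι = Metric.sphere (0 : EuclideanSpace ℝ (Fin 5)) 1 ∧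
      gaussianEntropy 4 (range ι) < gaussianEntropy 4 (shrinkingCylinder 4 1) := by
  obtain ⟨ι, hι, hr⟩ := exists_isSmoothEmbedding_range_eq_sphere_of_nonempty_diffeomorph M hM
  exact ⟨ι, hι, hr, hr ▸ gaussianEntropy_sphere_lt_shrinkingCylinder_four_one 0 one_pos⟩

/-- **`SmoothPoincare4 ⇒ ThinEmbeddingExists`, pointwise, in the literal inline shape of the
route's item `ThinEmbeddingExists`**: every `4`-manifold DIFFEOMORPHIC to `𝕊⁴` admits a `C^∞`
embedding `ι : M → ℝ⁵` with `ent(range ι) < ent({y | y₀² + y₁² = 2})`. This is the formal content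
of the route's remark that its existence half `E` is a consequence of SPC4 (so that a refutation of
`E` refutes SPC4). [cite: ChodoshMantoulidisSchulze2025, Rem. 1.9] -/
theorem exists_thinEmbedding_of_nonempty_diffeomorph_sphere (M : Type*) [TopologicalSpace M]
    [ChartedSpace (EuclideanSpace ℝ (Fin 4)) M] [IsManifold (𝓡 4) ∞ M]
    (hM : Nonempty (M ≃ₘ⟮𝓡 4, 𝓡 4⟯ Metric.sphere (0 : EuclideanSpace ℝ (Fin 5)) 1)) :
    ∃ ι : M → EuclideanSpace ℝ (Fin 5), Manifold.IsSmoothEmbedding (𝓡 4) (𝓡 5) ∞ ι ∧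
      (⨆ (p : EuclideanSpace ℝ (Fin 5)) (t : ℝ) (_ : 0 < t),
          (ENNReal.ofReal (t ^ 2))⁻¹ *
            ∫⁻ x in range ι, ENNReal.ofReal (Real.exp (-(‖x - p‖ ^ 2) / (4 * t))) ∂μH[4]) <
        ⨆ (p : EuclideanSpace ℝ (Fin 5)) (t : ℝ) (_ : 0 < t),
          (ENNReal.ofReal (t ^ 2))⁻¹ *
            ∫⁻ x in {y : EuclideanSpace ℝ (Fin 5) | y 0 ^ 2 + y 1 ^ 2 = 2},
              ENNReal.ofReal (Real.exp (-(‖x - p‖ ^ 2) / (4 * t))) ∂μH[4] := by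
  obtain ⟨ι, hι, -, hlt⟩ :=
    exists_isSmoothEmbedding_gaussianEntropy_lt_shrinkingCylinder_four_one M hM
  refine ⟨ι, hι, ?_⟩
  rw [← gaussianEntropy_four_lt_iff, ← shrinkingCylinder_four_one]
  exact hlt

end EntropyLadderRung

/-! ### The perturbation step: nearby maps are again embeddings (Hirsch / Guillemin–Pollack stability) -/

section Perturbation

/-- **The perturbation step of Cor. 1.22** ("we can find a small `C^∞` graph `M'` over `M`"): for
a family of maps `ι_s : M → ℝ⁵` of the compact `4`-manifold `M`, jointly `C^∞` in `(s, x)` for `s`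
in an open `U ∋ 0`, with `ι_0` a `C^∞` embedding, `ι_s` is again a `C^∞` embedding for all `s`
near `0` — so the perturbed hypersurface `M' = ι_s(M)` is a closed embedded hypersurface
diffeomorphic to `M` (by `ι_s ∘ ι_0⁻¹`), and the conclusion of the fact for `(M, ι_s)` is the
conclusion for `(M, ι_0)`. This is the stability of embeddings of compact manifolds (Hirsch,
*Differential Topology*, Ch. 2 §1, Thm. 1.4; Guillemin–Pollack, Ch. 1 §6), the tree's
`Literature.Geometry.Manifold.eventually_isSmoothEmbedding`, fed with the injectivity of the
differential of an immersion (`Literature.Topology.FourManifolds.Manifold.IsImmersionAt.mfderiv_injective`).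
[cite: ChodoshMantoulidisSchulze2025, Cor. 1.22, proof] [cite: HirschDT1976, Ch. 2 §1 Thm. 1.4] -/
theorem eventually_isSmoothEmbedding_of_isSmoothEmbedding_zero (M : Type*) [TopologicalSpace M]
    [CompactSpace M] [ChartedSpace (EuclideanSpace ℝ (Fin 4)) M] [IsManifold (𝓡 4) ∞ M]
    {ιs : ℝ → M → EuclideanSpace ℝ (Fin 5)} {U : Set ℝ} (hU : IsOpen U) (h0 : (0 : ℝ) ∈ U)
    (hιs : ContMDiffOn (𝓘(ℝ, ℝ).prod (𝓡 4)) (𝓡 5) ∞ (uncurry ιs) (U ×ˢ univ))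
    (hι : Manifold.IsSmoothEmbedding (𝓡 4) (𝓡 5) ∞ (ιs 0)) :
    ∀ᶠ s in 𝓝 (0 : ℝ), Manifold.IsSmoothEmbedding (𝓡 4) (𝓡 5) ∞ (ιs s) :=
  Literature.Geometry.Manifold.eventually_isSmoothEmbedding (I := 𝓡 4) (J := 𝓘(ℝ, ℝ)) hU hιs
    (by simp) h0 hι.isEmbedding.injective
    fun x => Literature.Topology.FourManifolds.Manifold.IsImmersionAt.mfderiv_injective
      (hι.isImmersion.isImmersionAt x) (by simp)

/-- The same for every member of the family: if `ι_{s₀}` is a `C^∞` embedding, `s₀ ∈ U`, then so is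
`ι_s` for `s` near `s₀`; moreover each such `ι_s(M)` has finite, `≥ 1` entropy
(`one_le_gaussianEntropy_range_and_lt_top_of_isSmoothEmbedding`).
[cite: HirschDT1976, Ch. 2 §1 Thm. 1.4] -/
theorem eventually_isSmoothEmbedding_of_isSmoothEmbedding (M : Type*) [TopologicalSpace M]
    [CompactSpace M] [ChartedSpace (EuclideanSpace ℝ (Fin 4)) M] [IsManifold (𝓡 4) ∞ M]
    {ιs : ℝ → M → EuclideanSpace ℝ (Fin 5)} {U : Set ℝ} (hU : IsOpen U) {s₀ : ℝ} (h0 : s₀ ∈ U)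
    (hιs : ContMDiffOn (𝓘(ℝ, ℝ).prod (𝓡 4)) (𝓡 5) ∞ (uncurry ιs) (U ×ˢ univ))
    (hι : Manifold.IsSmoothEmbedding (𝓡 4) (𝓡 5) ∞ (ιs s₀)) :
    ∀ᶠ s in 𝓝 s₀, Manifold.IsSmoothEmbedding (𝓡 4) (𝓡 5) ∞ (ιs s) :=
  Literature.Geometry.Manifold.eventually_isSmoothEmbedding (I := 𝓡 4) (J := 𝓘(ℝ, ℝ)) hU hιs
    (by simp) h0 hι.isEmbedding.injective
    fun x => Literature.Topology.FourManifolds.Manifold.IsImmersionAt.mfderiv_injective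
      (hι.isImmersion.isImmersionAt x) (by simp)

end Perturbation

/-! ### The round case of CMS Cor. 1.22 for `n = 4` as an explicit flow (tree vocabulary: `IsClassicalMCF`,
`levelSetFlow`, `gaussianArea`) -/

section RoundCaseFlow

open scoped ENNReal

/-- In the round case of Cor. 1.22 ("either `M` is a round sphere, in which case we are done") the
mean curvature flow is explicit: from `ι(M) = sphere c r ⊂ ℝ⁵` it is the homothetically
shrinking sphere about `c`, `R(t) = √(r² - 8t)`, extinct at `T = r²/8` — a classical MCF of the
tree (`IsClassicalMCF`) on every `[a, b]`, `b < r²/8`. [cite: ChodoshMantoulidisSchulze2025, Cor. 1.22, proof (round case)] -/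
theorem roundCase_isClassicalMCF (c : EuclideanSpace ℝ (Fin 5)) (r : ℝ) {a b : ℝ}
    (hb : b < r ^ 2 / 8) :
    IsClassicalMCF (euclideanMetric (EuclideanSpace ℝ (Fin 5)))
      (shrinkingSphereFlowAt 4 c (r ^ 2 / 8)) (shrinkingSphereNormalAt 4 c (r ^ 2 / 8)) a b :=
  isClassicalMCF_shrinkingSphereAt (by norm_num) c _ hb

/-- The radius of the round-case flow: `R(t) = √(r² - 8t)`. [cite: Huisken1984, §1] -/
theorem roundCase_radius (r t : ℝ) :
    shrinkingSphereRadius 4 (r ^ 2 / 8) t = Real.sqrt (r ^ 2 - 8 * t) := by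
  unfold shrinkingSphereRadius
  congr 1
  push_cast
  ring

/-- Its time-`0` slice is `ι(M) = sphere c r` (`r > 0`). [cite: Huisken1984, §1] -/
theorem roundCase_range_zero (c : EuclideanSpace ℝ (Fin 5)) {r : ℝ} (hr : 0 < r) :
    range (shrinkingSphereFlowAt 4 c (r ^ 2 / 8) 0) = sphere c r := by
  rw [range_shrinkingSphereFlowAt (by norm_num) c (by positivity), roundCase_radius, mul_zero, sub_zero,
    Real.sqrt_sq hr.le]

/-- Every slice before extinction is a round sphere of entropy `Λ₄ = 32/(3e²)`, strictly below the
cylindrical thresholds `λ(𝕊³ × ℝ) < λ(𝕊² × ℝ²)` of Cor. 1.5 (a), (b): the spherical singularity is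
the lowest generic stratum. [cite: ChodoshMantoulidisSchulze2025, Rem. 1.9] -/
theorem roundCase_slice (c : EuclideanSpace ℝ (Fin 5)) {r t : ℝ} (ht : t < r ^ 2 / 8) :
    range (shrinkingSphereFlowAt 4 c (r ^ 2 / 8) t) = sphere c (Real.sqrt (r ^ 2 - 8 * t)) ∧
      gaussianEntropy 4 (range (shrinkingSphereFlowAt 4 c (r ^ 2 / 8) t)) =
        ENNReal.ofReal (32 / (3 * Real.exp 1 ^ 2)) ∧
      gaussianEntropy 4 (range (shrinkingSphereFlowAt 4 c (r ^ 2 / 8) t)) <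
        gaussianEntropy 4 (shrinkingCylinder 4 3) := by
  have hrange : range (shrinkingSphereFlowAt 4 c (r ^ 2 / 8) t) =
      sphere c (Real.sqrt (r ^ 2 - 8 * t)) := by
    rw [range_shrinkingSphereFlowAt (by norm_num) c ht, roundCase_radius]
  have hR : 0 < Real.sqrt (r ^ 2 - 8 * t) := Real.sqrt_pos.2 (by linarith)
  refine ⟨hrange, ?_, ?_⟩
  · rw [hrange, gaussianEntropy_sphere_four c hR]
  · rw [hrange]
    exact gaussianEntropy_sphere_lt_shrinkingCylinder_four_three c hR

/-- **Huisken's density at the round singular point** `(c, r²/8)`: `F_{c, r²/8 - t}(M_t) = Λ₄` for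
all `t < r²/8` (translation of `gaussianArea_shrinkingSphereFlow`).
[cite: ColdingMinicozzi2012, (1.8) and Lemma 7.10] -/
theorem roundCase_gaussianArea (c : EuclideanSpace ℝ (Fin 5)) {r t : ℝ} (ht : t < r ^ 2 / 8) :
    gaussianArea 4 c (r ^ 2 / 8 - t) (range (shrinkingSphereFlowAt 4 c (r ^ 2 / 8) t)) =
      ENNReal.ofReal (sphereEntropy 4) := by
  have hcomp : shrinkingSphereFlowAt 4 c (r ^ 2 / 8) t =
      (IsometryEquiv.addLeft c) ∘ shrinkingSphereFlow 4 (r ^ 2 / 8) t := rfl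
  have h := gaussianArea_image_isometryEquiv (IsometryEquiv.addLeft c) 4
    (0 : EuclideanSpace ℝ (Fin 5)) (r ^ 2 / 8 - t) (range (shrinkingSphereFlow 4 (r ^ 2 / 8) t))
  rw [IsometryEquiv.addLeft_apply, add_zero] at h
  rw [hcomp, Set.range_comp, h, gaussianArea_shrinkingSphereFlow (by norm_num) ht]

/-- **The level set flow of the round `ι(M) = sphere c r` is extinct after time `r²/8`**
(Evans–Spruck Thm. 7.1 (a) via `levelSetFlow_eq_empty_of_lt`): "the flow … becomes a round
sphere" and disappears. [cite: EvansSpruck1991, Thm. 7.1 (a)] -/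
theorem roundCase_levelSetFlow_eq_empty (c : EuclideanSpace ℝ (Fin 5)) {r : ℝ} (hr : 0 < r) {t : ℝ}
    (ht : r ^ 2 / 8 < t) :
    levelSetFlow (euclideanMetric (EuclideanSpace ℝ (Fin 5))) (sphere c r) t = ∅ := by
  have h8t : r ^ 2 < 8 * t := by linarith
  have hs : r < Real.sqrt (8 * t) := (Real.lt_sqrt hr.le).2 h8t
  set ρ : ℝ := (r + Real.sqrt (8 * t)) / 2 with hρ
  have hρr : r < ρ := by rw [hρ]; linarith
  have hρs : ρ < Real.sqrt (8 * t) := by rw [hρ]; linarith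
  have hρ0 : 0 ≤ ρ := by linarith
  have hsub : sphere c r ⊆ ball c ρ := fun x hx ↦ by
    rw [mem_ball]
    rw [mem_sphere] at hx
    linarith
  refine levelSetFlow_eq_empty_of_lt (n := 4) (by norm_num) hsub ?_
  have h1 : ρ ^ 2 < Real.sqrt (8 * t) ^ 2 := by nlinarith
  rw [Real.sq_sqrt (by nlinarith [sq_nonneg r])] at h1
  push_cast
  linarith

/-- **Before extinction the level set flow of `sphere c r` stays in the shrinking closed balls**
`closedBall c √(r² - 8t)` (`0 ≤ t ≤ r²/8`); at `t = r²/8` it is contained in `{c}`.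
[cite: EvansSpruck1991, Thm. 7.1 (a), proof] -/
theorem roundCase_levelSetFlow_subset (c : EuclideanSpace ℝ (Fin 5)) {r : ℝ} (hr : 0 < r) {t : ℝ}
    (ht : t ≤ r ^ 2 / 8) :
    levelSetFlow (euclideanMetric (EuclideanSpace ℝ (Fin 5))) (sphere c r) t ⊆
      closedBall c (Real.sqrt (r ^ 2 - 8 * t)) := by
  intro x hx
  rw [mem_closedBall]
  by_contra hgt
  rw [not_le] at hgt
  set d : ℝ := dist x c with hd
  have hs0 : 0 ≤ Real.sqrt (r ^ 2 - 8 * t) := Real.sqrt_nonneg _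
  have hd0 : 0 < d := hs0.trans_lt hgt
  have hd2 : r ^ 2 - 8 * t < d ^ 2 := by
    have h1 : Real.sqrt (r ^ 2 - 8 * t) ^ 2 < d ^ 2 := by nlinarith
    rwa [Real.sq_sqrt (by linarith)] at h1
  -- enlarge the radius slightly: `sphere c r ⊆ ball c (r + ε)` with `(r + ε)² ≤ d² + 8t`
  set ε : ℝ := min 1 ((d ^ 2 + 8 * t - r ^ 2) / (2 * r + 1)) with hε
  have hεpos : 0 < ε := lt_min one_pos (div_pos (by linarith) (by linarith))
  have hε1 : ε ≤ 1 := min_le_left _ _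
  have hε2 : ε * (2 * r + 1) ≤ d ^ 2 + 8 * t - r ^ 2 := by
    have := min_le_right 1 ((d ^ 2 + 8 * t - r ^ 2) / (2 * r + 1))
    rw [← hε] at this
    rwa [le_div_iff₀ (by linarith)] at this
  have hre : (r + ε) ^ 2 ≤ d ^ 2 + 8 * t := by nlinarith [hεpos, hε1, hε2]
  have hsub : sphere c r ⊆ ball c (r + ε) := fun y hy ↦ by
    rw [mem_ball]
    rw [mem_sphere] at hy
    linarith
  have h := levelSetFlow_subset_ball (n := 4) (by norm_num) hsub (t := t)
    (by push_cast; nlinarith [hεpos]) hx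
  rw [mem_ball] at h
  have h1 : d ^ 2 < (Real.sqrt ((r + ε) ^ 2 - 2 * (4 : ℕ) * t)) ^ 2 := by
    rw [← hd] at h
    nlinarith [h, hd0, Real.sqrt_nonneg ((r + ε) ^ 2 - 2 * (4 : ℕ) * t)]
  rw [Real.sq_sqrt (by push_cast; nlinarith [hεpos])] at h1
  push_cast at h1
  linarith

end RoundCaseFlow

/-! ### The weak (level set) flow of the embedded hypersurface `ι(M)` and of the round case
(tree vocabulary: `levelSetFlow`, `IsWeakSetFlowIn`) -/

section WeakFlow

open scoped ENNReal

/-- In the round case the level set flow of `ι(M) = sphere c r ⊂ ℝ⁵` IS the shrinking sphere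
`sphere c √(r² - 8t)` for `0 ≤ t < r²/8` (`levelSetFlow_sphere`: the classical sphere flow is a
weak set flow, and outer/inner sphere barriers), `⊆ {c}` at `t = r²/8`, `∅` afterwards
(`roundCase_levelSetFlow_eq_empty`): the weak flow through the spherical singularity of
Cor. 1.22's round case is explicit. [cite: EvansSpruck1991, §7.1 (7.2)–(7.3)]
[cite: ChodoshMantoulidisSchulze2025, Cor. 1.22, proof (round case)] -/
theorem roundCase_levelSetFlow_eq (c : EuclideanSpace ℝ (Fin 5)) {r : ℝ} (hr : 0 < r) {t : ℝ}
    (ht0 : 0 ≤ t) (ht : t < r ^ 2 / 8) :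
    levelSetFlow (euclideanMetric (EuclideanSpace ℝ (Fin 5))) (sphere c r) t =
      sphere c (Real.sqrt (r ^ 2 - 8 * t)) := by
  have h := levelSetFlow_sphere (n := 4) (by norm_num) c hr ht0 (t := t) (by push_cast; linarith)
  rw [h]
  push_cast
  ring_nf

/-- At the extinction time `T = r²/8` of the round case only the centre can survive:
`F_T(sphere c r) ⊆ {c}`. [cite: EvansSpruck1991, §7.1 (7.2)] -/
theorem roundCase_levelSetFlow_extinction (c : EuclideanSpace ℝ (Fin 5)) {r : ℝ} (hr : 0 < r) :
    levelSetFlow (euclideanMetric (EuclideanSpace ℝ (Fin 5))) (sphere c r) (r ^ 2 / 8) ⊆ {c} :=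
  levelSetFlow_sphere_subset_singleton (n := 4) (by norm_num) c hr (by push_cast; ring)

/-- **The level set flow of the embedded hypersurface `ι(M)` is a weak set flow** (White's
biggest flow exists): for a compact `4`-manifold `M` and a continuous (e.g. smoothly embedded)
`ι : M → ℝ⁵`, `t ↦ F_t(ι(M))` is a weak set flow in `ℝ⁵` on `[0, ∞)`
(`isWeakSetFlowIn_levelSetFlow`, `LevelSetFlowWeakSetFlow.lean`, for the closed set `ι(M)`), the
unique biggest one from inside `ι(M)` (`subset_levelSetFlow`). This is the weak mean curvature
flow of `M` through singularities in the set-theoretic sense (White 2000, §2), the level-set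
companion of the Brakke flows `𝔉(M)` of the printed proof of Cor. 1.5.
[cite: White2000, §2] [cite: ChodoshMantoulidisSchulze2025, §1 (weak flows of `M`)] -/
theorem isWeakSetFlowIn_levelSetFlow_range
    (M : Type*) [TopologicalSpace M] [CompactSpace M] {ι : M → EuclideanSpace ℝ (Fin 5)}
    (hι : Continuous ι) :
    IsWeakSetFlowIn (euclideanMetric (EuclideanSpace ℝ (Fin 5))) univ (Ici 0)
      (levelSetFlow (euclideanMetric (EuclideanSpace ℝ (Fin 5))) (range ι)) :=
  isWeakSetFlowIn_levelSetFlow (n := 4) (by norm_num) (isCompact_range hι).isClosed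

/-- Its time slices `F_t(ι(M))` are compact, and its spacetime track is closed.
[cite: White2000, §2] -/
theorem isCompact_levelSetFlow_range
    (M : Type*) [TopologicalSpace M] [CompactSpace M] {ι : M → EuclideanSpace ℝ (Fin 5)}
    (hι : Continuous ι) (t : ℝ) :
    IsCompact (levelSetFlow (euclideanMetric (EuclideanSpace ℝ (Fin 5))) (range ι) t) ∧
      IsClosed {p : EuclideanSpace ℝ (Fin 5) × ℝ |
        0 ≤ p.2 ∧ p.1 ∈ levelSetFlow (euclideanMetric (EuclideanSpace ℝ (Fin 5))) (range ι) p.2} :=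
  ⟨isCompact_levelSetFlow (n := 4) (by norm_num) (isCompact_range hι) t,
    isClosed_track_levelSetFlow (n := 4) (by norm_num) (isCompact_range hι).isClosed⟩

/-- **Avoidance principle for the weak flow of `ι(M)`**: a classical mean curvature flow of closed
hypersurfaces on `[a, b]`, `a ≥ 0`, disjoint from `F_a(ι(M))` stays disjoint from `F_t(ι(M))`
(White 2000, §2). [cite: White2000, §2] -/
theorem levelSetFlow_range_avoidance
    (M : Type*) [TopologicalSpace M] [CompactSpace M] {ι : M → EuclideanSpace ℝ (Fin 5)}
    (hι : Continuous ι) {N' : Type} [TopologicalSpace N'] [ChartedSpace (EuclideanSpace ℝ (Fin 4)) N']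
    [IsManifold (𝓡 4) ∞ N'] {F' : ℝ → N' → EuclideanSpace ℝ (Fin 5)}
    {ν' : (t : ℝ) → Lorentzian.NormalField (𝓡 5) (F' t)} {a b : ℝ} (ha : 0 ≤ a) (hab : a ≤ b)
    (hF' : IsClassicalMCF (euclideanMetric (EuclideanSpace ℝ (Fin 5))) F' ν' a b)
    (hdis : Disjoint (range (F' a))
      (levelSetFlow (euclideanMetric (EuclideanSpace ℝ (Fin 5))) (range ι) a))
    {t : ℝ} (ht : t ∈ Icc a b) :
    Disjoint (range (F' t)) (levelSetFlow (euclideanMetric (EuclideanSpace ℝ (Fin 5))) (range ι) t) :=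
  levelSetFlow_avoidance (n := 4) (by norm_num) (isCompact_range hι).isClosed ha hab hF' hdis ht

/-- **Finite extinction of the weak flow of `ι(M)`**: `F_t(ι(M)) = ∅` for all `t > T` for some
`T < ∞` (`ι(M)` is bounded; Evans–Spruck 1991, Thm. 7.1 (a)), and once empty it stays empty
(`levelSetFlow_eq_empty_of_eq_empty`). [cite: EvansSpruck1991, Thm. 7.1 (a)] -/
theorem exists_levelSetFlow_range_eq_empty
    (M : Type*) [TopologicalSpace M] [CompactSpace M] {ι : M → EuclideanSpace ℝ (Fin 5)}
    (hι : Continuous ι) :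
    ∃ T : ℝ, ∀ t, T < t → levelSetFlow (euclideanMetric (EuclideanSpace ℝ (Fin 5))) (range ι) t = ∅ :=
  exists_levelSetFlow_eq_empty_of_isBounded (n := 4) (by norm_num) (isCompact_range hι).isBounded

end WeakFlow


/-! ### The low-entropy hypothesis is preserved along a classical mean curvature flow -/

section EntropyAlongFlow

open scoped ENNReal

/-- **The entropy hypotheses of the fact propagate along a classical mean curvature flow**
(Huisken's monotonicity ⇒ Colding–Minicozzi's Lemma 1.11, `MCFEntropyMonotonicity.lean`): if a
compact `4`-manifold moves by (classical, embedded) mean curvature flow `F` in `ℝ⁵` on `[a, b]`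
and the initial slice satisfies `λ(F_a(N)) ≤ Λ`, then so does every slice `F_t(N)`, `t ∈ [a, b)` —
in particular with `Λ = λ(𝕊³(√6) × ℝ)` or `λ(𝕊²(2) × ℝ²)`, the thresholds of the fact. No
measurable structure on `N` is needed in the statement (the Borel one is used in the proof).
[cite: ColdingMinicozzi2012, Lemma 1.11] [cite: Huisken1990, Thm. 3.1] -/
theorem gaussianEntropy_range_le_of_isClassicalMCF
    {N : Type*} [TopologicalSpace N] [ChartedSpace (EuclideanSpace ℝ (Fin 4)) N]
    [IsManifold (𝓡 4) ∞ N] [CompactSpace N] [T2Space N]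
    {F : ℝ → N → EuclideanSpace ℝ (Fin 5)} {ν : (t : ℝ) → Lorentzian.NormalField (𝓡 5) (F t)}
    {a b : ℝ} (hF : IsClassicalMCF (euclideanMetric (EuclideanSpace ℝ (Fin 5))) F ν a b)
    {Λ : ℝ≥0∞} (h₀ : gaussianEntropy 4 (range (F a)) ≤ Λ) {t : ℝ} (ht : t ∈ Ico a b) :
    gaussianEntropy 4 (range (F t)) ≤ Λ := by
  letI : MeasurableSpace N := borel N
  haveI : BorelSpace N := ⟨rfl⟩
  have h := hF.gaussianEntropy_image_le_initial (n := 4) ht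
  rw [image_univ, image_univ] at h
  exact h.trans h₀

/-- **All Gaussian densities of the flow are bounded by the initial entropy**: for `T ∈ (a, b]`,
`x₀ ∈ ℝ⁵` and `s ∈ (a, T)`, Huisken's Gaussian density
`Θ(x₀, T) = lim_{t↑T} F_{x₀,T-t}(F_t(N))` (which exists, `IsClassicalMCF.tendsto_gaussianArea_image`)
satisfies `Θ(x₀, T) ≤ λ(F_a(N))` — so a flow from low-entropy initial data has only low-entropy
blow-ups, the starting point of [ChodoshMantoulidisSchulze2025], §1.6.
[cite: ColdingMinicozzi2012, Lemma 1.11] [cite: Huisken1990, Thm. 3.1] -/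
theorem gaussianDensity_le_gaussianEntropy_range_of_isClassicalMCF
    {N : Type*} [TopologicalSpace N] [ChartedSpace (EuclideanSpace ℝ (Fin 4)) N]
    [IsManifold (𝓡 4) ∞ N] [CompactSpace N] [T2Space N]
    {F : ℝ → N → EuclideanSpace ℝ (Fin 5)} {ν : (t : ℝ) → Lorentzian.NormalField (𝓡 5) (F t)}
    {a b : ℝ} (hF : IsClassicalMCF (euclideanMetric (EuclideanSpace ℝ (Fin 5))) F ν a b)
    (x₀ : EuclideanSpace ℝ (Fin 5)) {T : ℝ} (hT : T ∈ Ioc a b) {s : ℝ} (hs : s ∈ Ioo a T) :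
    sInf ((fun t ↦ gaussianArea 4 x₀ (T - t) (range (F t))) '' Ioo a T) ≤
      gaussianEntropy 4 (range (F a)) := by
  letI : MeasurableSpace N := borel N
  haveI : BorelSpace N := ⟨rfl⟩
  have h := hF.gaussianDensity_le_gaussianEntropy (n := 4) x₀ hT hs
  simp only [image_univ] at h
  exact h.1.trans h.2

end EntropyAlongFlow


/-! ### Uniform local area bounds and Gaussian densities along a classical flow in `ℝ⁵` -/

section AlongFlowConsequences

open _root_.MeasureTheory _root_.MeasureTheory.Measure _root_.Filter
open scoped ENNReal Topology

/-- **Uniform area-ratio bounds along a classical mean curvature flow in `ℝ⁵`** from the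
initial entropy: `𝓗⁴(F_t(N) ∩ B̄_R(p)) ≤ e^{1/4} (4π)² R⁴ · λ(F_a(N))` for all `t ∈ [a, b)`,
`p ∈ ℝ⁵`, `R > 0` (`MCFEntropyMonotonicity.lean`). With `λ(F_a(N)) ≤ λ(𝕊³(√6) × ℝ)` (the fact's
hypothesis) these are the uniform local mass bounds of the would-be Brakke flows `𝔉(M)`.
[cite: ColdingMinicozzi2012, Lemma 1.11 and (2.8)] -/
theorem hausdorffMeasure_range_inter_closedBall_le_of_isClassicalMCF
    {N : Type*} [TopologicalSpace N] [ChartedSpace (EuclideanSpace ℝ (Fin 4)) N]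
    [IsManifold (𝓡 4) ∞ N] [CompactSpace N] [T2Space N]
    {F : ℝ → N → EuclideanSpace ℝ (Fin 5)} {ν : (t : ℝ) → Lorentzian.NormalField (𝓡 5) (F t)}
    {a b : ℝ} (hF : IsClassicalMCF (euclideanMetric (EuclideanSpace ℝ (Fin 5))) F ν a b)
    {t : ℝ} (ht : t ∈ Ico a b) (p : EuclideanSpace ℝ (Fin 5)) {R : ℝ} (hR : 0 < R) :
    (μHE[4] : Measure (EuclideanSpace ℝ (Fin 5))) (range (F t) ∩ Metric.closedBall p R) ≤
      ENNReal.ofReal (Real.exp (1 / 4) * (4 * Real.pi) ^ ((4 : ℝ) / 2) * R ^ 4) *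
        gaussianEntropy 4 (range (F a)) := by
  letI : MeasurableSpace N := borel N
  haveI : BorelSpace N := ⟨rfl⟩
  have h := hF.measure_inter_closedBall_image_le (n := 4) ht p hR
  simp only [image_univ] at h
  exact_mod_cast h

/-- **Gaussian densities of a classical flow in `ℝ⁵`: `1` on the slice** — for `T ∈ (a, b]` and
`w₀ ∈ N`, `F_{F_T(w₀), T-t}(F_t(N)) → 1` as `t ↑ T` (`MCFRegularPointDensity.lean`; no measurable
structure on `N` is needed in the statement). [cite: Huisken1990, Thm. 3.1]
[cite: ColdingMinicozzi2012, Lemma 7.2 (3)] -/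
theorem tendsto_gaussianArea_range_of_isClassicalMCF
    {N : Type*} [TopologicalSpace N] [ChartedSpace (EuclideanSpace ℝ (Fin 4)) N]
    [IsManifold (𝓡 4) ∞ N] [CompactSpace N] [T2Space N]
    {F : ℝ → N → EuclideanSpace ℝ (Fin 5)} {ν : (t : ℝ) → Lorentzian.NormalField (𝓡 5) (F t)}
    {a b : ℝ} (hF : IsClassicalMCF (euclideanMetric (EuclideanSpace ℝ (Fin 5))) F ν a b)
    {T : ℝ} (hT : T ∈ Ioc a b) (w₀ : N) :
    Tendsto (fun t ↦ gaussianArea 4 (F T w₀) (T - t) (range (F t))) (𝓝[<] T) (𝓝 1) := by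
  letI : MeasurableSpace N := borel N
  haveI : BorelSpace N := ⟨rfl⟩
  have h := hF.tendsto_gaussianArea_image_regular (n := 4) hT w₀
  simp only [image_univ] at h
  exact h

end AlongFlowConsequences

end Literature.Geometry.Riemannian

end
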